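import Literature.Geometry.Kaehler.ComplexTorusIntegralLefschetzDecompositionDegreeThree
import Mathlib.LinearAlgebra.Matrix.SchurComplement
import HarnessLib

/-!
# Integral hard Lefschetz in degree three: the EXACT index of `θ^{g−3} ∧ H³(X, ℤ)` in `H^{2g−3}(X, ℤ)`
# for a polarised complex torus of type `(d₁, …, d_g)` — in particular the middle-adjacent map `θ ∧ : H³ → H⁵` of a fourfold

Layer `Literature/Geometry/Kaehler`, namespace `Literature.Geometry.Kaehler.ComplexTorus`; lane `lit-hodgefound` (Track 2
foundations library), seat p09, generation 37, row g37-#2. THEOREMS ONLY (0 definitions); no named fact, net debt 0. Sequel of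
g35-#1 (degree one), g35-#3 (degree two) and g37-#1 `ComplexTorusIntegralLefschetzDecompositionDegreeThree` (the co-Lefschetz map
`θ^{g−2} ∧ : H³ → H^{2g−1}`, whose sign-free expansion `θ^{∧q} ∧ dx_w = q! Σ_T (∏_{ν ∈ T} d_ν) dx_{(λμ)_T ++ w}` is used here).

Source (the statement being made precise): Lange 2023 §5.4.1 Thm. 5.4.1 (PDF p. 275): "the Kähler form `ω` determines an isomorphism
`L^{n−r} : Hʳ(M, ℂ) → H^{2n−r}(M, ℂ)` for `0 ≤ r ≤ n`" and (5.22) "Since the Lefschetz operator `L` is defined over `ℤ` …"; Voisin 2002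
§6.2.3 Thm. 6.25 (PDF p. 125) and §7.1.2 (PDF p. 134 L31: "the operator `L` acts on the integral cohomology"). The tree's g31-#5
`ComplexTorusIntegralHardLefschetz` has `L^{g−k} : Hᵏ(X, ℤ) → H^{2g−k}(X, ℤ)` injective with FINITE cokernel; its order is computed
here for `k = 3`, every `g ≥ 3` and every type.

Setting: complex torus `X = E/Φ(ℤ^ι)` of dimension `g = j + 3`, polarisation `θ = ofRealForm η` of type `d₁ ∣ ⋯ ∣ d_g` with a
symplectic enumeration `e₀` of the lattice basis (Lemma 2.5.14: `θ = Σ d_ν dx_{λ_ν} ∧ dx_{μ_ν}`), `L = θ^{∧j} ∧ (−) : H³(X, ℤ) → H^{2g−3}(X, ℤ)`.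
Letters `x : Fin g ⊕ Fin g` (`λ_a = inl a`, `μ_a = inr a`), index `a(x)`, partner `x̄`; `s_a = Fin.succAbove a` enumerates the
indices `≠ a`. A three-letter word is (§3) EITHER `(x_a, x_b, x_c)` on three indices `a < b < c` (the type `A`, `8 C(g,3)` words)
OR a pair word `(λ_i, μ_i, x)` with `i = s_{a(x)}(k) ≠ a(x)` (`2g (g−1)` words); this "free-letter datum"
`K = A ⊕ (Fin (g−1) × letters)` indexes `ℤ`-bases of BOTH `H³(X, ℤ)` and `H^{2g−3}(X, ℤ)` (§4: the target word of `(x_a,x_b,x_c)` is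
`(λμ)_{{a,b,c}ᶜ} ++ (x_a,x_b,x_c)`, that of `(k, x)` is `(λμ)_{{a(x), s_{a(x)}(k)}ᶜ} ++ (x)`; both families are the
increasing-monomial basis `intLatMonomialBasis` up to order and sign), and in these bases the matrix of `L` is BLOCK DIAGONAL (§2, §6):

* `θ^{∧(g−3)} ∧ dx_{(x_a,x_b,x_c)} = (g−3)! (∏_{ν ∉ {a,b,c}} d_ν) · dx_{(λμ)_{{a,b,c}ᶜ} ++ (x_a,x_b,x_c)}` — `1 × 1` blocks;
* `θ^{∧(g−3)} ∧ dx_{(λ_i, μ_i, x)} = (g−3)! Σ_{i' ∉ {a(x), i}} (∏_{ν ∉ {a(x),i,i'}} d_ν) · dx_{(λμ)_{{a(x),i'}ᶜ} ++ (x)}` — for each free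
  letter `x` a `(g−1) × (g−1)` block `B_x = ((g−3)! · [i ≠ i'] · ∏_{ν ∉ {a(x),i,i'}} d_ν)` with ALL SIGNS `+`, because a pair
  `dx_{λ_ν} ∧ dx_{μ_ν}` commutes past everything (§1: the monomial of an interleaved word does not depend on the enumeration of its
  pairs, so the pair `(λ_i, μ_i)` is absorbed into the interleaved block without sign); and (§5)
  `diag(d ∘ s_a) · B_x · diag(d ∘ s_a) = (g−3)! (∏_{ν ≠ a} d_ν) · (J − 1)`, `|det(J − 1)| = g − 2`, so
  `|det B_x| = ((g−3)!)^{g−1} (∏_{ν ≠ a(x)} d_ν)^{g−3} (g−2)`.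

Hence (§6, the index of a full-rank sublattice is `|det|`) the **exact index**

  `[H^{2g−3}(X, ℤ) : θ^{g−3} ∧ H³(X, ℤ)] = ∏_{(x_a,x_b,x_c) ∈ A} (g−3)! ∏_{ν ∉ {a,b,c}} d_ν · ∏_{x} ((g−3)!)^{g−1} (∏_{ν ≠ a(x)} d_ν)^{g−3} (g−2)`,

for a principal polarisation `((g−3)!)^{C(2g, 3)} · (g−2)^{2g}` (`#A + 2g(g−1) = C(2g, 3) = rk H³`, counted through the basis):
**on a principally polarised abelian fourfold the middle-adjacent Lefschetz map `θ ∧ (−) : H³(X, ℤ) → H⁵(X, ℤ)` has cokernel of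
order `2^8`**, on a p.p. fivefold `[H⁷ : θ² ∧ H³] = 2^{120} 3^{10}`; basis-free forms (any presentation, THE type, principal) in §7.

## References

* [cite: Lange2023AbelianVarietiesComplex, §5.4.1 Thm. 5.4.1 and (5.22) (PDF p. 275); §2.5.3 Lemma 2.5.14, Thm. 2.5.16, Cor. 2.5.17
  (PDF p. 135); §1.5.1 (types, PDF p. 51); §2.1.1 (principal); §1.1.3 Exercise 1.1.6 (7)–(8); §1.1.4 Prop. 1.1.20; §6.2.4 proof of
  Prop. 6.2.20 (PDF p. 310)]
* [cite: VoisinHodgeI2002, §6.2.3 Thm. 6.25 (PDF p. 125); §7.1.2 (PDF p. 134 L31)]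
* [cite: Warner1983, 2.6 (reordering a monomial is a sign; even forms are central)]
-/

noncomputable section

open Module Function
open Literature.LinearAlgebra.Alternating

namespace Literature.Geometry.Kaehler.ComplexTorus

section HardLefschetzDegreeThree

variable {ι : Type*} [Fintype ι] [DecidableEq ι] {E : Type*} [NormedAddCommGroup E] [NormedSpace ℂ E]
  (Φ : (ι → ℝ) ≃L[ℝ] E) {j : ℕ} {e₀ : Fin (j + 3) ⊕ Fin (j + 3) ≃ ι} {η : E [⋀^Fin 2]→L[ℝ] ℝ} {d : Fin (j + 3) → ℕ}

/-! ## §1 Pairs commute: the monomial of an interleaved word does not depend on the enumeration of its pairs -/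

omit [Fintype ι] [DecidableEq ι] in
/-- Reindexing a lattice monomial along an equation of lengths. [folklore] -/
private theorem latMonomial_comp_finCast₃₇' {m n : ℕ} (h : m = n) (w : Fin n → ι) :
    latMonomial Φ m (w ∘ Fin.cast h) = (latMonomial Φ n w).domDomCongr (finCongr h.symm) := by
  subst h; rfl

omit [Fintype ι] [DecidableEq ι] in
/-- Composing two reindexings. [folklore] -/
private theorem domDomCongr_finCongr_trans₃₇ {m n p : ℕ} (h₁ : m = n) (h₂ : n = p) (β : E [⋀^Fin m]→L[ℝ] ℂ) :
    (β.domDomCongr (finCongr h₁)).domDomCongr (finCongr h₂) = β.domDomCongr (finCongr (h₁.trans h₂)) := by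
  subst h₁; subst h₂; rfl

omit [Fintype ι] [DecidableEq ι] in
/-- Two reindexings along (proof-irrelevantly) equal length equations agree. [folklore] -/
private theorem domDomCongr_finCongr_irrel₃₇ {m n : ℕ} (h₁ h₂ : m = n) (β : E [⋀^Fin m]→L[ℝ] ℂ) :
    β.domDomCongr (finCongr h₁) = β.domDomCongr (finCongr h₂) := rfl

section AnyDimension

variable {g : ℕ} (e₁ : Fin g ⊕ Fin g ≃ ι)

omit [Fintype ι] [DecidableEq ι] in
/-- **The monomial `∧_ν (dx_{λ_{t ν}} ∧ dx_{μ_{t ν}})` of an interleaved word does not depend on the order of the pairs**: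
`dx_{ilvWord (t ∘ σ)} = dx_{ilvWord t}` for every permutation `σ` (the reordering of the interleaved word is the lift `σ ⊕ σ` of `σ` to
the pairs, of sign `sign(σ)² = 1`; even forms commute). [cite: Warner1983, 2.6] -/
theorem latMonomial_ilvWord_comp_perm {q : ℕ} (t : Fin q → Fin g) (σ : Equiv.Perm (Fin q)) :
    latMonomial Φ (2 * q) (ilvWord e₁ (t ∘ σ)) = latMonomial Φ (2 * q) (ilvWord e₁ t) := by
  set π : Equiv.Perm (Fin (2 * q)) := (finTwoMulEquivSum q).symm.permCongr (Equiv.Perm.sumCongr σ σ) with hπ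
  have hw : ilvWord e₁ (t ∘ σ) = ilvWord e₁ t ∘ π := by
    funext m
    rw [comp_apply, ilvWord_apply, ilvWord_apply, hπ, Equiv.permCongr_apply, Equiv.symm_symm, Equiv.apply_symm_apply]
    cases finTwoMulEquivSum q m <;> rfl
  have hsign : Equiv.Perm.sign π = 1 := by
    rw [hπ, Equiv.Perm.sign_permCongr, Equiv.Perm.sign_sumCongr, Int.units_mul_self]
  rw [hw, latMonomial_eq_sign_smul_comp_perm Φ (ilvWord e₁ t) π, hsign, Units.val_one, Int.cast_one, one_smul]

omit [Fintype ι] [DecidableEq ι] e₁ in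
/-- Two injective enumerations of the same finite set differ by a permutation. [folklore] -/
private theorem exists_perm_comp_eq₃₇ {α : Type*} {n : ℕ} {f₁ f₂ : Fin n → α} (h₁ : Injective f₁) (h₂ : Injective f₂)
    (h : Set.range f₁ = Set.range f₂) : ∃ σ : Equiv.Perm (Fin n), f₁ = f₂ ∘ σ := by
  refine ⟨((Equiv.ofInjective f₁ h₁).trans (Equiv.setCongr h)).trans (Equiv.ofInjective f₂ h₂).symm, funext fun m ↦ ?_⟩
  rw [comp_apply, Equiv.trans_apply, Equiv.trans_apply]
  have := Equiv.apply_ofInjective_symm h₂ (Equiv.setCongr h (Equiv.ofInjective f₁ h₁ m))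
  rw [this]
  rfl

omit [Fintype ι] [DecidableEq ι] in
/-- **Two injective enumerations of the same set of indices give the same monomial** `∧_{ν ∈ T} dx_{λ_ν} ∧ dx_{μ_ν}`.
[cite: Lange2023AbelianVarietiesComplex, §2.5.3 Thm. 2.5.16 (the monomials `∧_{ν ∈ T} dx_ν ∧ dx_{g+ν}` of a SET `T`)] -/
theorem latMonomial_ilvWord_eq_of_range_eq {q : ℕ} {t₁ t₂ : Fin q → Fin g} (h₁ : Injective t₁) (h₂ : Injective t₂)
    (h : Set.range t₁ = Set.range t₂) : latMonomial Φ (2 * q) (ilvWord e₁ t₁) = latMonomial Φ (2 * q) (ilvWord e₁ t₂) := by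
  obtain ⟨σ, hσ⟩ := exists_perm_comp_eq₃₇ h₁ h₂ h
  rw [hσ, latMonomial_ilvWord_comp_perm]

omit [Fintype ι] [DecidableEq ι] in
/-- **Absorbing a pair into the interleaved block**: `dx_{(λμ)_T ++ (λ_i, μ_i, x)} = dx_{(λμ)_{T'} ++ (x)}` (reindexed to the common
length `2q + 3`) for any injective enumerations `t` of `T ∌ i` and `t'` of `T' = T ∪ {i}`: the pair `dx_{λ_i} ∧ dx_{μ_i}` is moved
into the interleaved block (`(λμ)_T ∧ (λμ)_i = (λμ)_{T, i}`, §1) — NO SIGN. [cite: Lange2023AbelianVarietiesComplex, §2.5.3 Lemma 2.5.14 and Thm. 2.5.16 (PDF p. 135)] [cite: Warner1983, 2.6] -/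
theorem latMonomial_append_ilvWord_pair_eq {q : ℕ} {t : Fin q → Fin g} (ht : Injective t) {i : Fin g}
    (hi : i ∉ Set.range t) {t' : Fin (q + 1) → Fin g} (ht' : Injective t') (hrange : Set.range t' = insert i (Set.range t))
    (x : Fin g ⊕ Fin g) (hc : 2 * q + 3 = 2 * (q + 1) + 1) :
    latMonomial Φ (2 * q + 3) (Fin.append (ilvWord e₁ t) ![e₁ (Sum.inl i), e₁ (Sum.inr i), e₁ x]) =
      latMonomial Φ (2 * q + 3) ((Fin.append (ilvWord e₁ t') (fun _ : Fin 1 ↦ e₁ x)) ∘ Fin.cast hc) := by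
  -- the three-letter tail is `(λμ)_i ++ (x)`
  have htail : (![e₁ (Sum.inl i), e₁ (Sum.inr i), e₁ x] : Fin 3 → ι) =
      Fin.append (ilvWord e₁ ![i]) (fun _ : Fin 1 ↦ e₁ x) := by
    funext m
    fin_cases m
    · rfl
    · rfl
    · rfl
  -- the enumeration `t ++ (i)` of `T'`
  have hti : Injective (Fin.append t ![i]) := by
    refine Fin.append_injective_iff.2 ⟨ht, injective_of_subsingleton _, fun m m' h ↦ hi ⟨m, ?_⟩⟩
    rw [h]
    fin_cases m'
    rfl
  have hrange' : Set.range (Fin.append t ![i]) = Set.range t' := by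
    rw [hrange]
    ext ν
    constructor
    · rintro ⟨m, rfl⟩
      induction m using Fin.addCases with
      | left m => rw [Fin.append_left]; exact Set.mem_insert_of_mem _ ⟨m, rfl⟩
      | right m => rw [Fin.append_right]; fin_cases m; exact Set.mem_insert _ _
    · rintro (rfl | ⟨m, rfl⟩)
      · exact ⟨Fin.natAdd q 0, by rw [Fin.append_right]; rfl⟩
      · exact ⟨Fin.castAdd 1 m, by rw [Fin.append_left]⟩
  have hpair : latMonomial Φ (2 * q + 2 * 1) (Fin.append (ilvWord e₁ t) (ilvWord e₁ ![i])) =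
      (latMonomial Φ (2 * (q + 1)) (ilvWord e₁ t')).domDomCongr (finCongr (by ring : 2 * (q + 1) = 2 * q + 2 * 1)) := by
    rw [append_ilvWord e₁ (by ring : 2 * q + 2 * 1 = 2 * (q + 1)) t ![i], latMonomial_comp_finCast₃₇',
      latMonomial_ilvWord_eq_of_range_eq Φ e₁ hti ht' hrange']
  -- re-bracket `(λμ)_T ∧ ((λμ)_i ∧ dx_x) = ((λμ)_T ∧ (λμ)_i) ∧ dx_x`
  have e0 : latMonomial Φ (2 * q + 3) (Fin.append (ilvWord e₁ t) ![e₁ (Sum.inl i), e₁ (Sum.inr i), e₁ x]) =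
      (latMonomial Φ (2 * q) (ilvWord e₁ t)).wedge
        ((latMonomial Φ (2 * 1) (ilvWord e₁ ![i])).wedge (latMonomial Φ 1 fun _ : Fin 1 ↦ e₁ x)) := by
    rw [latMonomial_wedge_latMonomial, latMonomial_wedge_latMonomial, htail]
  have hassoc := ContinuousAlternatingMap.WedgeAssoc_holds ℝ E ℂ (latMonomial Φ (2 * q) (ilvWord e₁ t))
    (latMonomial Φ (2 * 1) (ilvWord e₁ ![i])) (latMonomial Φ 1 fun _ : Fin 1 ↦ e₁ x)
  -- `hassoc : (A ∧ B) ∧ C = (A ∧ (B ∧ C)).domDomCongr (finCongr (Nat.add_assoc _ _ _).symm)`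
  have e1 : (latMonomial Φ (2 * q) (ilvWord e₁ t)).wedge
      ((latMonomial Φ (2 * 1) (ilvWord e₁ ![i])).wedge (latMonomial Φ 1 fun _ : Fin 1 ↦ e₁ x)) =
      (((latMonomial Φ (2 * q) (ilvWord e₁ t)).wedge (latMonomial Φ (2 * 1) (ilvWord e₁ ![i]))).wedge
        (latMonomial Φ 1 fun _ : Fin 1 ↦ e₁ x)).domDomCongr (finCongr (Nat.add_assoc (2 * q) (2 * 1) 1)) := by
    rw [hassoc, domDomCongr_finCongr_trans₃₇]
    rfl
  rw [e0, e1, latMonomial_wedge_latMonomial, hpair, domDomCongr_finCongr_wedge, latMonomial_wedge_latMonomial,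
    domDomCongr_finCongr_trans₃₇, latMonomial_comp_finCast₃₇']

variable {e₁} {d₁ : Fin g → ℕ}

/-- **One surviving index set.** If every `q`-set of indices other than `T₀` contains the index of a letter of the word `w`, then
`θ^{∧q} ∧ dx_w = q! · (∏_{ν ∈ T₀} d_ν) · dx_{(λμ)_{T₀} ++ w}` (all other terms of Thm. 2.5.16 repeat a letter).
[cite: Lange2023AbelianVarietiesComplex, §2.5.3 Thm. 2.5.16 (PDF p. 135)] -/
theorem IsSymplecticEnum.wedgePow_wedge_latMonomial_eq_single (h : IsSymplecticEnum Φ e₁ η d₁) (q : ℕ) {k : ℕ}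
    (w : Fin k → ι) (T₀ : Set.powersetCard (Fin g) q)
    (hT : ∀ T : Set.powersetCard (Fin g) q, T ≠ T₀ →
      ∃ (p : Fin k) (x : Fin g ⊕ Fin g), w p = e₁ x ∧ Sum.elim id id x ∈ (T : Finset (Fin g))) :
    (wedgePow (ofRealForm η) q).wedge (latMonomial Φ k w) =
      (q.factorial : ℂ) • ((∏ ν ∈ (T₀ : Finset (Fin g)), (d₁ ν : ℂ)) •
        latMonomial Φ (2 * q + k) (Fin.append (ilvWord e₁ (Set.powersetCard.ofFinEmbEquiv.symm T₀)) w)) := by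
  classical
  rw [h.wedgePow_wedge_latMonomial_eq_sum Φ q w, Finset.sum_eq_single T₀]
  · intro T _ hne
    obtain ⟨p, x, hw, hx⟩ := hT T hne
    rw [latMonomial_append_ilvWord_eq_zero_of_index_mem Φ e₁ hw
      ((Set.powersetCard.mem_range_ofFinEmbEquiv_symm_iff_mem T _).2 (Set.powersetCard.mem_coe_iff.1 hx))]
    ext v; simp
  · exact fun hT₀ ↦ absurd (Finset.mem_univ _) hT₀

end AnyDimension

/-! ## §2 `L = θ^{∧(g−3)} ∧ (−)` on the three-letter words (`g = j + 3`) -/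

/-- **Three free letters**: for a word `(x₀, x₁, x₂)` whose indices miss exactly the `(g−3)`-set `T₀`
(`T₀ = {a(x₀), a(x₁), a(x₂)}ᶜ`, three distinct indices), `θ^{∧(g−3)} ∧ dx_{(x₀,x₁,x₂)} = (g−3)! (∏_{ν ∈ T₀} d_ν) dx_{(λμ)_{T₀} ++ (x₀,x₁,x₂)}`
— a single monomial. [cite: Lange2023AbelianVarietiesComplex, §2.5.3 Thm. 2.5.16 (PDF p. 135) and §5.4.1 Thm. 5.4.1 (PDF p. 275)] -/
theorem IsSymplecticEnum.wedgePow_wedge_latMonomial_three_free_eq_single (h : IsSymplecticEnum Φ e₀ η d)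
    (u : Fin 3 → Fin (j + 3) ⊕ Fin (j + 3)) (T₀ : Set.powersetCard (Fin (j + 3)) j)
    (hT₀ : (T₀ : Finset (Fin (j + 3))) = (Finset.univ.image fun m ↦ Sum.elim id id (u m))ᶜ) :
    (wedgePow (ofRealForm η) j).wedge (latMonomial Φ 3 (⇑e₀ ∘ u)) =
      (j.factorial : ℂ) • ((∏ ν ∈ (T₀ : Finset (Fin (j + 3))), (d ν : ℂ)) •
        latMonomial Φ (2 * j + 3) (Fin.append (ilvWord e₀ (Set.powersetCard.ofFinEmbEquiv.symm T₀)) (⇑e₀ ∘ u))) := by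
  classical
  refine h.wedgePow_wedge_latMonomial_eq_single Φ j (⇑e₀ ∘ u) T₀ fun T hne ↦ ?_
  -- a `j`-set `T ≠ T₀` is not contained in `T₀`, so it contains an index of `u`
  have hnot : ¬ (T : Finset (Fin (j + 3))) ⊆ (T₀ : Finset (Fin (j + 3))) := fun hsub ↦ hne (Subtype.ext
    (Finset.eq_of_subset_of_card_le hsub (by rw [Set.powersetCard.card_eq, Set.powersetCard.card_eq])))
  obtain ⟨ν, hνT, hν⟩ := Finset.not_subset.1 hnot
  rw [hT₀, Finset.mem_compl, not_not, Finset.mem_image] at hν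
  obtain ⟨m, -, rfl⟩ := hν
  exact ⟨m, u m, rfl, hνT⟩

/-- The index set `{a, s_a(k), s_a(k')}ᶜ` (`s_a = Fin.succAbove a`) has `g − 3 = j` elements for `k ≠ k'`. [folklore] -/
private theorem card_compl_triple₃₇ (a : Fin (j + 3)) {k k' : Fin (j + 2)} (hk : k' ≠ k) :
    (({a, a.succAbove k, a.succAbove k'} : Finset (Fin (j + 3)))ᶜ).card = j := by
  have h1 : a ∉ ({a.succAbove k, a.succAbove k'} : Finset (Fin (j + 3))) := by
    rw [Finset.mem_insert, Finset.mem_singleton, not_or]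
    exact ⟨(Fin.succAbove_ne a k).symm, (Fin.succAbove_ne a k').symm⟩
  rw [Finset.card_compl, Finset.card_insert_of_notMem h1,
    Finset.card_pair (Fin.succAbove_right_injective.ne hk.symm), Fintype.card_fin]
  omega

/-- **One free letter and a pair**: for the word `(λ_i, μ_i, x)` with `i = s_a(k) ≠ a = a(x)` (`s_a = Fin.succAbove a` enumerates the
indices `≠ a`), `θ^{∧(g−3)} ∧ dx_{(λ_i, μ_i, x)} = (g−3)! Σ_{k' ≠ k} (∏_{ν ∉ {a, i, s_a(k')}} d_ν) · dx_{(λμ)_{{a, s_a(k')}ᶜ} ++ (x)}`: the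
surviving `(g−3)`-sets are `{a, i, i'}ᶜ`, `i' = s_a(k')`, and the pair `(λ_i, μ_i)` is absorbed into the interleaved block WITHOUT SIGN
(§1). The target monomials are written with any chosen `(g−2)`-sets `T'(k') = {a, s_a(k')}ᶜ`.
[cite: Lange2023AbelianVarietiesComplex, §2.5.3 Lemma 2.5.14 and Thm. 2.5.16 (PDF p. 135); §5.4.1 Thm. 5.4.1 (PDF p. 275)] [cite: Warner1983, 2.6] -/
theorem IsSymplecticEnum.wedgePow_wedge_latMonomial_pair_free_eq_sum (h : IsSymplecticEnum Φ e₀ η d)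
    (x : Fin (j + 3) ⊕ Fin (j + 3)) (k : Fin (j + 2)) (T' : Fin (j + 2) → Set.powersetCard (Fin (j + 3)) (j + 1))
    (hT' : ∀ k', ((T' k' : Set.powersetCard (Fin (j + 3)) (j + 1)) : Finset (Fin (j + 3))) =
      ({Sum.elim id id x, (Sum.elim id id x).succAbove k'} : Finset (Fin (j + 3)))ᶜ)
    (hc : 2 * j + 3 = 2 * (j + 1) + 1) :
    (wedgePow (ofRealForm η) j).wedge (latMonomial Φ 3
        ![e₀ (Sum.inl ((Sum.elim id id x).succAbove k)), e₀ (Sum.inr ((Sum.elim id id x).succAbove k)), e₀ x]) =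
      (j.factorial : ℂ) • ∑ k' : Fin (j + 2),
        (if k' = k then (0 : ℂ) else ∏ ν ∈ ({Sum.elim id id x, (Sum.elim id id x).succAbove k,
            (Sum.elim id id x).succAbove k'} : Finset (Fin (j + 3)))ᶜ, (d ν : ℂ)) •
          latMonomial Φ (2 * j + 3)
            ((Fin.append (ilvWord e₀ (Set.powersetCard.ofFinEmbEquiv.symm (T' k'))) (fun _ : Fin 1 ↦ e₀ x)) ∘ Fin.cast hc) := by
  classical
  set a : Fin (j + 3) := Sum.elim id id x with ha
  set s : Fin (j + 2) → Fin (j + 3) := a.succAbove with hs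
  rw [h.wedgePow_wedge_latMonomial_eq_sum Φ j]
  congr 1
  -- drop the vanishing term `k' = k` on the right
  rw [← Finset.sum_subset (Finset.subset_univ ({k}ᶜ : Finset (Fin (j + 2)))) (fun k' _ hk' ↦ ?_)]
  swap
  · rw [Finset.mem_compl, not_not, Finset.mem_singleton] at hk'
    rw [if_pos hk']
    ext v
    simp
  -- on the left only the `j`-sets avoiding `a` and `s k` survive
  rw [← Finset.sum_subset (Finset.filter_subset
    (fun T : Set.powersetCard (Fin (j + 3)) j ↦ a ∉ (T : Finset (Fin (j + 3))) ∧ s k ∉ (T : Finset (Fin (j + 3)))) Finset.univ)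
    (fun T _ hT ↦ ?_)]
  swap
  · rw [Finset.mem_filter, not_and, not_and_or, not_not, not_not] at hT
    rcases hT (Finset.mem_univ _) with hm | hm
    · rw [latMonomial_append_ilvWord_eq_zero_of_index_mem Φ e₀ (p := (2 : Fin 3)) (x := x) rfl
        ((Set.powersetCard.mem_range_ofFinEmbEquiv_symm_iff_mem T _).2 (Set.powersetCard.mem_coe_iff.1 hm))]
      ext v; simp
    · rw [latMonomial_append_ilvWord_eq_zero_of_index_mem Φ e₀ (p := (0 : Fin 3)) (x := Sum.inl (s k)) rfl
        ((Set.powersetCard.mem_range_ofFinEmbEquiv_symm_iff_mem T _).2 (Set.powersetCard.mem_coe_iff.1 hm))]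
      ext v; simp
  symm
  -- the bijection `k' ↦ {a, s k, s k'}ᶜ` from `{k}ᶜ` onto the surviving `j`-sets
  refine Finset.sum_bij (fun k' hk' ↦ Set.powersetCard.ofCard (card_compl_triple₃₇ a (k := k) (k' := k')
      (by rwa [Finset.mem_compl, Finset.mem_singleton] at hk'))) ?_ ?_ ?_ ?_
  · -- lands in the surviving sets
    intro k' _
    simp [Finset.mem_filter, Set.powersetCard.val_ofCard, hs]
  · -- injective
    intro k₁ hk₁ k₂ hk₂ heq
    rw [Finset.mem_compl, Finset.mem_singleton] at hk₁ hk₂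
    have h1 : (({a, s k, s k₁} : Finset (Fin (j + 3)))ᶜ) = ({a, s k, s k₂} : Finset (Fin (j + 3)))ᶜ :=
      congrArg (fun T : Set.powersetCard (Fin (j + 3)) j ↦ (T : Finset (Fin (j + 3)))) heq
    rw [compl_inj_iff] at h1
    have h2 : s k₁ ∈ ({a, s k, s k₂} : Finset (Fin (j + 3))) := by rw [← h1]; simp
    rw [Finset.mem_insert, Finset.mem_insert, Finset.mem_singleton] at h2
    rcases h2 with h2 | h2 | h2
    · exact absurd h2 (Fin.succAbove_ne a k₁)
    · exact absurd (Fin.succAbove_right_injective h2) hk₁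
    · exact Fin.succAbove_right_injective h2
  · -- surjective: a `j`-set avoiding `a` and `s k` is `{a, s k, s k'}ᶜ` for the index `s k'` it omits
    intro T hT
    rw [Finset.mem_filter] at hT
    obtain ⟨-, haT, hkT⟩ := hT
    have hsub : (T : Finset (Fin (j + 3))) ⊆ ({a, s k} : Finset (Fin (j + 3)))ᶜ := fun ν hν ↦ by
      rw [Finset.mem_compl, Finset.mem_insert, Finset.mem_singleton, not_or]
      exact ⟨fun h1 ↦ haT (h1 ▸ hν), fun h1 ↦ hkT (h1 ▸ hν)⟩
    have hcard : ((({a, s k} : Finset (Fin (j + 3)))ᶜ) \ (T : Finset (Fin (j + 3)))).card = 1 := by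
      rw [Finset.card_sdiff_of_subset hsub, Finset.card_compl, Finset.card_pair (Fin.succAbove_ne a k).symm,
        Set.powersetCard.card_eq, Fintype.card_fin]
      omega
    obtain ⟨i', hi'⟩ := Finset.card_eq_one.1 hcard
    have hi'mem : i' ∈ (({a, s k} : Finset (Fin (j + 3)))ᶜ) \ (T : Finset (Fin (j + 3))) := by
      rw [hi']; exact Finset.mem_singleton_self _
    rw [Finset.mem_sdiff, Finset.mem_compl, Finset.mem_insert, Finset.mem_singleton, not_or] at hi'mem
    obtain ⟨⟨hi'a, hi'k⟩, hi'T⟩ := hi'mem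
    obtain ⟨k', hk'⟩ := Fin.exists_succAbove_eq hi'a
    have hk'k : k' ≠ k := fun h1 ↦ hi'k (by rw [← hk', h1])
    refine ⟨k', by rwa [Finset.mem_compl, Finset.mem_singleton], Subtype.ext ?_⟩
    change (({a, s k, s k'} : Finset (Fin (j + 3)))ᶜ) = (T : Finset (Fin (j + 3)))
    ext ν
    rw [Finset.mem_compl, Finset.mem_insert, Finset.mem_insert, Finset.mem_singleton, not_or, not_or]
    constructor
    · rintro ⟨h1, h2, h3⟩
      by_contra hν
      have hν' : ν ∈ (({a, s k} : Finset (Fin (j + 3)))ᶜ) \ (T : Finset (Fin (j + 3))) := by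
        rw [Finset.mem_sdiff, Finset.mem_compl, Finset.mem_insert, Finset.mem_singleton, not_or]
        exact ⟨⟨h1, h2⟩, hν⟩
      rw [hi', Finset.mem_singleton] at hν'
      exact h3 (by rw [hν', ← hk'])
    · intro hν
      have h12 := hsub hν
      rw [Finset.mem_compl, Finset.mem_insert, Finset.mem_singleton, not_or] at h12
      refine ⟨h12.1, h12.2, fun h3 ↦ hi'T ?_⟩
      rw [← hk']
      rw [h3] at hν
      exact hν
  · -- the values agree: the pair `(λ_{s k}, μ_{s k})` is absorbed into the interleaved block (§1)
    intro k' hk'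
    rw [Finset.mem_compl, Finset.mem_singleton] at hk'
    rw [if_neg hk']
    have hcoe : ((Set.powersetCard.ofCard (card_compl_triple₃₇ a (k := k) (k' := k') hk') :
        Set.powersetCard (Fin (j + 3)) j) : Finset (Fin (j + 3))) = ({a, s k, s k'} : Finset (Fin (j + 3)))ᶜ := rfl
    rw [hcoe, latMonomial_append_ilvWord_pair_eq Φ e₀ (Set.powersetCard.ofFinEmbEquiv.symm _).injective ?_
      (Set.powersetCard.ofFinEmbEquiv.symm (T' k')).injective ?_ x hc]
    · intro hmem
      have h1 := Set.powersetCard.mem_coe_iff.2 ((Set.powersetCard.mem_range_ofFinEmbEquiv_symm_iff_mem _ _).1 hmem)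
      rw [hcoe] at h1
      simp at h1
    · ext ν
      rw [Set.mem_insert_iff, Set.powersetCard.mem_range_ofFinEmbEquiv_symm_iff_mem,
        Set.powersetCard.mem_range_ofFinEmbEquiv_symm_iff_mem, ← Set.powersetCard.mem_coe_iff,
        ← Set.powersetCard.mem_coe_iff, hT', hcoe]
      simp only [Finset.mem_compl, Finset.mem_insert, Finset.mem_singleton, not_or]
      constructor
      · rintro ⟨h1, h2⟩
        by_cases h3 : ν = s k
        · exact Or.inl h3
        · exact Or.inr ⟨h1, h3, h2⟩
      · rintro (rfl | ⟨h1, h2, h3⟩)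
        · exact ⟨Fin.succAbove_ne a k, fun h1 ↦ hk' (Fin.succAbove_right_injective h1).symm⟩
        · exact ⟨h1, h3⟩


/-! ## §3 Letter sets: a three-letter word is `(x_a, x_b, x_c)` on three indices `a < b < c` or `(λ_i, μ_i, x)`, `i ≠ a(x)` -/

section Letters

variable {g : ℕ}

/-- A letter is not its own partner. [cite: Lange2023AbelianVarietiesComplex, §2.5.3 (p. 133)] -/
private theorem swap_ne_self₃₇ (x : Fin g ⊕ Fin g) : x.swap ≠ x := by
  cases x <;> simp

/-- Partners have the same index. [cite: Lange2023AbelianVarietiesComplex, §2.5.3 (p. 133)] -/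
private theorem index_swap₃₇ (x : Fin g ⊕ Fin g) : Sum.elim id id x.swap = Sum.elim id id x := by
  cases x <;> rfl

/-- A letter is `λ_{a(x)}` or `μ_{a(x)}`. [folklore] -/
private theorem eq_inl_or_eq_inr₃₇ (x : Fin g ⊕ Fin g) :
    x = Sum.inl (Sum.elim id id x) ∨ x = Sum.inr (Sum.elim id id x) := by
  cases x
  · exact Or.inl rfl
  · exact Or.inr rfl

/-- Two letters with the same index are equal or partners. [cite: Lange2023AbelianVarietiesComplex, §2.5.3 (p. 133)] -/
private theorem eq_or_eq_swap_of_index_eq₃₇ {z x : Fin g ⊕ Fin g}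
    (h : Sum.elim id id z = Sum.elim id id x) : z = x ∨ z = x.swap := by
  rcases z with i | i <;> rcases x with i' | i' <;> simp only [Sum.elim_inl, Sum.elim_inr, id_eq] at h <;> subst h <;> simp

/-- In `Fin 3`, three pairwise distinct positions exhaust all positions. [folklore] -/
private theorem fin3_eq_or_eq_or_eq₃₇ {p q r : Fin 3} (hpq : q ≠ p) (hrp : r ≠ p) (hrq : r ≠ q) (s : Fin 3) :
    s = p ∨ s = q ∨ s = r := by
  revert p q r s
  decide

/-- In `Fin 3`, two distinct positions leave a third. [folklore] -/
private theorem fin3_exists_third₃₇ {p q : Fin 3} (hpq : q ≠ p) : ∃ r : Fin 3, r ≠ p ∧ r ≠ q := by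
  revert p q
  decide

/-- Three pairwise distinct entries give an injective `3`-vector. [folklore] -/
private theorem injective_vec3₃₇ {α : Type*} {u v w : α} (huv : u ≠ v) (huw : u ≠ w) (hvw : v ≠ w) :
    Injective ![u, v, w] := by
  intro i k hik
  fin_cases i <;> fin_cases k <;> simp at hik ⊢ <;>
    first | exact (huv hik).elim | exact (huw hik).elim | exact (hvw hik).elim | exact (huv hik.symm).elim |
      exact (huw hik.symm).elim | exact (hvw hik.symm).elim

/-- The letters of a `3`-vector. [folklore] -/
private theorem mem_range_vec3_iff₃₇ {α : Type*} {u v w : α} (z : α) : z ∈ Set.range ![u, v, w] ↔ z = u ∨ z = v ∨ z = w := by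
  constructor
  · rintro ⟨m, rfl⟩
    fin_cases m <;> simp
  · rintro (rfl | rfl | rfl)
    exacts [⟨0, rfl⟩, ⟨1, rfl⟩, ⟨2, rfl⟩]

/-- The letters of a concatenated word. [folklore] -/
private theorem mem_range_append_iff₃₇ {α : Type*} {m n : ℕ} (f : Fin m → α) (f' : Fin n → α) (b : α) :
    b ∈ Set.range (Fin.append f f') ↔ b ∈ Set.range f ∨ b ∈ Set.range f' := by
  constructor
  · rintro ⟨i, rfl⟩
    induction i using Fin.addCases with
    | left i => rw [Fin.append_left]; exact Or.inl ⟨i, rfl⟩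
    | right i => rw [Fin.append_right]; exact Or.inr ⟨i, rfl⟩
  · rintro (⟨i, rfl⟩ | ⟨i, rfl⟩)
    exacts [⟨Fin.castAdd n i, Fin.append_left f f' i⟩, ⟨Fin.natAdd m i, Fin.append_right f f' i⟩]

/-- `a < b < c` is `StrictMono` for an index word of length three. [folklore] -/
private theorem strictMono_vec3_iff₃₇ {β : Type*} [Preorder β] (f : Fin 3 → β) : StrictMono f ↔ f 0 < f 1 ∧ f 1 < f 2 := by
  rw [Fin.strictMono_iff_lt_succ]
  constructor
  · exact fun h ↦ ⟨h 0, h 1⟩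
  · intro h i
    fin_cases i
    exacts [h.1, h.2]

/-- The pair word `(λ_i, μ_i, x)` (`i ≠ a(x)`) is injective. [folklore] -/
private theorem injective_pairWord₃₇ {i : Fin g} {x : Fin g ⊕ Fin g} (hi : i ≠ Sum.elim id id x) :
    Injective ![(Sum.inl i : Fin g ⊕ Fin g), Sum.inr i, x] :=
  injective_vec3₃₇ Sum.inl_ne_inr (fun h ↦ hi (by rw [← h]; rfl)) (fun h ↦ hi (by rw [← h]; rfl))

/-- **Three free letters determine the word**: two words on three increasing indices with the same letters are equal. [folklore] -/
private theorem eq_of_range_eq_of_strictMono_index₃₇ {u₁ u₂ : Fin 3 → Fin g ⊕ Fin g}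
    (h₁ : StrictMono fun m ↦ Sum.elim id id (u₁ m)) (h₂ : StrictMono fun m ↦ Sum.elim id id (u₂ m))
    (h : Set.range u₁ = Set.range u₂) : u₁ = u₂ := by
  have hidx : (fun m ↦ Sum.elim id id (u₁ m)) = fun m ↦ Sum.elim id id (u₂ m) := by
    refine (h₁.range_inj h₂).1 ?_
    change Set.range (Sum.elim id id ∘ u₁) = Set.range (Sum.elim id id ∘ u₂)
    rw [Set.range_comp, Set.range_comp, h]
  funext m
  obtain ⟨m', hm'⟩ : u₁ m ∈ Set.range u₂ := h ▸ ⟨m, rfl⟩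
  have hmm : m' = m := by
    apply h₂.injective
    change Sum.elim id id (u₂ m') = Sum.elim id id (u₂ m)
    rw [← show Sum.elim id id (u₁ m) = Sum.elim id id (u₂ m) from congrFun hidx m, ← hm']
  rw [← hm', hmm]

/-- **A pair word is not a free word**: the letters of `(λ_i, μ_i, x)` are not the letters of a word on three distinct indices. [folklore] -/
private theorem range_ne_range_pairWord₃₇ {u : Fin 3 → Fin g ⊕ Fin g} (hu : StrictMono fun m ↦ Sum.elim id id (u m))
    (i : Fin g) (x : Fin g ⊕ Fin g) : Set.range u ≠ Set.range ![(Sum.inl i : Fin g ⊕ Fin g), Sum.inr i, x] := by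
  intro h
  obtain ⟨m, hm⟩ : (Sum.inl i : Fin g ⊕ Fin g) ∈ Set.range u := by rw [h]; exact ⟨0, rfl⟩
  obtain ⟨m', hm'⟩ : (Sum.inr i : Fin g ⊕ Fin g) ∈ Set.range u := by rw [h]; exact ⟨1, rfl⟩
  have hmm : m = m' := hu.injective (by rw [hm, hm']; rfl)
  rw [hmm, hm'] at hm
  exact Sum.inr_ne_inl hm

/-- **The pair and the free letter determine the word**: `{λ_{i₁}, μ_{i₁}, x₁} = {λ_{i₂}, μ_{i₂}, x₂}` (`i_r ≠ a(x_r)`) forces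
`i₁ = i₂` and `x₁ = x₂`. [folklore] -/
private theorem eq_of_range_pairWord_eq₃₇ {i₁ i₂ : Fin g} {x₁ x₂ : Fin g ⊕ Fin g} (h₁ : i₁ ≠ Sum.elim id id x₁)
    (h₂ : i₂ ≠ Sum.elim id id x₂)
    (h : Set.range ![(Sum.inl i₁ : Fin g ⊕ Fin g), Sum.inr i₁, x₁] = Set.range ![(Sum.inl i₂ : Fin g ⊕ Fin g), Sum.inr i₂, x₂]) :
    i₁ = i₂ ∧ x₁ = x₂ := by
  have hl : (Sum.inl i₁ : Fin g ⊕ Fin g) ∈ Set.range ![(Sum.inl i₂ : Fin g ⊕ Fin g), Sum.inr i₂, x₂] := by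
    rw [← h]; exact ⟨0, rfl⟩
  have hr : (Sum.inr i₁ : Fin g ⊕ Fin g) ∈ Set.range ![(Sum.inl i₂ : Fin g ⊕ Fin g), Sum.inr i₂, x₂] := by
    rw [← h]; exact ⟨1, rfl⟩
  rw [mem_range_vec3_iff₃₇] at hl hr
  have hi : i₁ = i₂ := by
    rcases hl with hl | hl | hl
    · exact Sum.inl_injective hl
    · exact absurd hl Sum.inl_ne_inr
    · rcases hr with hr | hr | hr
      · exact absurd hr Sum.inr_ne_inl
      · exact Sum.inr_injective hr
      · exact absurd (hl.trans hr.symm) Sum.inl_ne_inr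
  subst hi
  refine ⟨rfl, ?_⟩
  have hx : x₁ ∈ Set.range ![(Sum.inl i₁ : Fin g ⊕ Fin g), Sum.inr i₁, x₂] := by rw [← h]; exact ⟨2, rfl⟩
  rw [mem_range_vec3_iff₃₇] at hx
  rcases hx with hx | hx | hx
  · exact absurd (by rw [hx]; rfl) h₁
  · exact absurd (by rw [hx]; rfl) h₁
  · exact hx

/-- **Classification of the three-letter words** (`g = j + 3`): an injective three-letter word has the letters of a word
`(x_a, x_b, x_c)` on three increasing indices, or of a pair word `(λ_i, μ_i, x)` with `i = s_{a(x)}(k)`.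
[cite: Lange2023AbelianVarietiesComplex, §2.5.3 (p. 133: the basis `λ₁, …, μ_g`)] -/
private theorem exists_range_eq₃₇ (z : Fin 3 → Fin (j + 3) ⊕ Fin (j + 3)) (hz : Injective z) :
    (∃ u : Fin 3 → Fin (j + 3) ⊕ Fin (j + 3), StrictMono (fun m ↦ Sum.elim id id (u m)) ∧ Set.range u = Set.range z) ∨
    (∃ (x : Fin (j + 3) ⊕ Fin (j + 3)) (k : Fin (j + 2)),
      Set.range ![(Sum.inl ((Sum.elim id id x).succAbove k) : Fin (j + 3) ⊕ Fin (j + 3)),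
        Sum.inr ((Sum.elim id id x).succAbove k), x] = Set.range z) := by
  classical
  by_cases hinj : Injective fun m ↦ Sum.elim id id (z m)
  · -- three distinct indices: sort the word by index
    left
    refine ⟨z ∘ ⇑(Tuple.sort fun m ↦ Sum.elim id id (z m)),
      (Tuple.monotone_sort fun m ↦ Sum.elim id id (z m)).strictMono_of_injective
        (hinj.comp (Tuple.sort fun m ↦ Sum.elim id id (z m)).injective),
      (Tuple.sort fun m ↦ Sum.elim id id (z m)).surjective.range_comp z⟩
  · -- a repeated index: a pair `(λ_i, μ_i)` and a third letter `x` of another index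
    right
    obtain ⟨m, m', hmm', hne⟩ := Function.not_injective_iff.1 hinj
    have hswap : z m' = (z m).swap := by
      rcases eq_or_eq_swap_of_index_eq₃₇ hmm'.symm with h1 | h1
      · exact absurd (hz h1).symm hne
      · exact h1
    obtain ⟨m'', hm''m, hm''m'⟩ := fin3_exists_third₃₇ (p := m) (q := m') (Ne.symm hne)
    have hxi : Sum.elim id id (z m) ≠ Sum.elim id id (z m'') := fun hxi ↦ by
      rcases eq_or_eq_swap_of_index_eq₃₇ hxi.symm with h1 | h1
      · exact hm''m (hz h1)
      · exact hm''m' (hz (h1.trans hswap.symm))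
    obtain ⟨k, hk⟩ := Fin.exists_succAbove_eq hxi
    refine ⟨z m'', k, ?_⟩
    rw [hk]
    ext y
    rw [mem_range_vec3_iff₃₇]
    constructor
    · rintro (rfl | rfl | rfl)
      · rcases eq_inl_or_eq_inr₃₇ (z m) with h1 | h1
        · exact ⟨m, h1⟩
        · exact ⟨m', by rw [hswap, h1]; rfl⟩
      · rcases eq_inl_or_eq_inr₃₇ (z m) with h1 | h1
        · exact ⟨m', by rw [hswap, h1]; rfl⟩
        · exact ⟨m, h1⟩
      · exact ⟨m'', rfl⟩
    · rintro ⟨p, rfl⟩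
      rcases fin3_eq_or_eq_or_eq₃₇ (Ne.symm hne) hm''m hm''m' p with rfl | rfl | rfl
      · rcases eq_inl_or_eq_inr₃₇ (z p) with h1 | h1
        · exact Or.inl h1
        · exact Or.inr (Or.inl h1)
      · rcases eq_inl_or_eq_inr₃₇ (z m) with h1 | h1
        · exact Or.inr (Or.inl (by rw [hswap, h1]; rfl))
        · exact Or.inl (by rw [hswap, h1]; rfl)
      · exact Or.inr (Or.inr rfl)

end Letters


/-! ## §4 The `ℤ`-bases of `H³(X, ℤ)` and `H^{2g−3}(X, ℤ)` indexed by the free-letter datum (`g = j + 3`)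

The index type is `K = A ⊕ (Fin (g−1) × letters)`: `A` = the words `(x_a, x_b, x_c)` on three indices `a < b < c` (`8 C(g,3)` of them),
and `(k, x)` stands for the pair word `(λ_i, μ_i, x)` with `i = s_{a(x)}(k)` the `k`-th index `≠ a(x)`. -/

omit [Fintype ι] [DecidableEq ι] in
/-- The letters of the increasing word of a subset are its elements (the tree's `strictMonoEquivPowersetCard`). [folklore] -/
private theorem mem_range_strictMonoEquivPowersetCard_symm_iff₃₇ [LinearOrder ι] {k : ℕ} (R : Set.powersetCard ι k) (a : ι) :
    a ∈ Set.range ((strictMonoEquivPowersetCard ι k).symm R).1 ↔ a ∈ R :=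
  Set.powersetCard.mem_range_ofFinEmbEquiv_symm_iff_mem R a

omit [Fintype ι] [DecidableEq ι] in
/-- The pair word in letters is `e₀ ∘ (λ_i, μ_i, x)`. [folklore] -/
private theorem pairWord_eq_comp₃₇ (e₀ : Fin (j + 3) ⊕ Fin (j + 3) ≃ ι) (i : Fin (j + 3)) (x : Fin (j + 3) ⊕ Fin (j + 3)) :
    (![e₀ (Sum.inl i), e₀ (Sum.inr i), e₀ x] : Fin 3 → ι) = ⇑e₀ ∘ ![(Sum.inl i : Fin (j + 3) ⊕ Fin (j + 3)), Sum.inr i, x] := by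
  funext m
  fin_cases m <;> rfl

omit [Fintype ι] [DecidableEq ι] in
/-- The three-letter words of the free-letter datum are injective. [folklore] -/
private theorem injective_word₃₇ (e₀ : Fin (j + 3) ⊕ Fin (j + 3) ≃ ι) (k : ({u : Fin 3 → Fin (j + 3) ⊕ Fin (j + 3) // Sum.elim id id (u 0) < Sum.elim id id (u 1) ∧ Sum.elim id id (u 1) < Sum.elim id id (u 2)} ⊕ Fin (j + 2) × (Fin (j + 3) ⊕ Fin (j + 3)))) :
    Injective (Sum.elim (fun u : {u : Fin 3 → Fin (j + 3) ⊕ Fin (j + 3) // Sum.elim id id (u 0) < Sum.elim id id (u 1) ∧ Sum.elim id id (u 1) < Sum.elim id id (u 2)} ↦ ⇑e₀ ∘ u.1)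
        (fun p : Fin (j + 2) × (Fin (j + 3) ⊕ Fin (j + 3)) ↦ ![e₀ (Sum.inl ((Sum.elim id id p.2).succAbove p.1)),
          e₀ (Sum.inr ((Sum.elim id id p.2).succAbove p.1)), e₀ p.2]) k) := by
  rcases k with u | ⟨k, x⟩
  · exact e₀.injective.comp
      (show Injective (Sum.elim id id ∘ u.1) from ((strictMono_vec3_iff₃₇ _).2 u.2).injective).of_comp
  · change Injective ![e₀ (Sum.inl ((Sum.elim id id x).succAbove k)), e₀ (Sum.inr ((Sum.elim id id x).succAbove k)), e₀ x]
    rw [pairWord_eq_comp₃₇]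
    exact e₀.injective.comp (injective_pairWord₃₇ (Fin.succAbove_ne _ k))

omit [Fintype ι] [DecidableEq ι] in
/-- **The free-letter datum enumerates the increasing three-letter words**: `K ≃ {w : Fin 3 → ι // StrictMono w}` matching
letter sets (classification §3). [cite: Lange2023AbelianVarietiesComplex, §1.1.3 Exercise 1.1.6 (8) (the basis `dx_I`, `#I = 3`)] -/
private theorem exists_equiv_range_word_eq₃₇ [LinearOrder ι] (e₀ : Fin (j + 3) ⊕ Fin (j + 3) ≃ ι) :
    ∃ ψ : ({u : Fin 3 → Fin (j + 3) ⊕ Fin (j + 3) // Sum.elim id id (u 0) < Sum.elim id id (u 1) ∧ Sum.elim id id (u 1) < Sum.elim id id (u 2)} ⊕ Fin (j + 2) × (Fin (j + 3) ⊕ Fin (j + 3))) ≃ {w : Fin 3 → ι // StrictMono w},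
      ∀ k, Set.range (Sum.elim (fun u : {u : Fin 3 → Fin (j + 3) ⊕ Fin (j + 3) // Sum.elim id id (u 0) < Sum.elim id id (u 1) ∧ Sum.elim id id (u 1) < Sum.elim id id (u 2)} ↦ ⇑e₀ ∘ u.1)
        (fun p : Fin (j + 2) × (Fin (j + 3) ⊕ Fin (j + 3)) ↦ ![e₀ (Sum.inl ((Sum.elim id id p.2).succAbove p.1)),
          e₀ (Sum.inr ((Sum.elim id id p.2).succAbove p.1)), e₀ p.2]) k) = Set.range (ψ k).1 := by
  classical
  set F : ({u : Fin 3 → Fin (j + 3) ⊕ Fin (j + 3) // Sum.elim id id (u 0) < Sum.elim id id (u 1) ∧ Sum.elim id id (u 1) < Sum.elim id id (u 2)} ⊕ Fin (j + 2) × (Fin (j + 3) ⊕ Fin (j + 3))) → Fin 3 → ι :=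
    Sum.elim (fun u : {u : Fin 3 → Fin (j + 3) ⊕ Fin (j + 3) // Sum.elim id id (u 0) < Sum.elim id id (u 1) ∧ Sum.elim id id (u 1) < Sum.elim id id (u 2)} ↦ ⇑e₀ ∘ u.1)
        (fun p : Fin (j + 2) × (Fin (j + 3) ⊕ Fin (j + 3)) ↦ ![e₀ (Sum.inl ((Sum.elim id id p.2).succAbove p.1)),
          e₀ (Sum.inr ((Sum.elim id id p.2).succAbove p.1)), e₀ p.2]) with hFdef
  have hFl : ∀ u, F (Sum.inl u) = ⇑e₀ ∘ u.1 := fun _ ↦ rfl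
  have hFr : ∀ k x, F (Sum.inr (k, x)) = ⇑e₀ ∘ ![(Sum.inl ((Sum.elim id id x).succAbove k) : Fin (j + 3) ⊕ Fin (j + 3)),
      Sum.inr ((Sum.elim id id x).succAbove k), x] := fun k x ↦ pairWord_eq_comp₃₇ e₀ _ x
  have hmono : ∀ u : {u : Fin 3 → Fin (j + 3) ⊕ Fin (j + 3) // Sum.elim id id (u 0) < Sum.elim id id (u 1) ∧ Sum.elim id id (u 1) < Sum.elim id id (u 2)},
      StrictMono fun m ↦ Sum.elim id id (u.1 m) := fun u ↦ (strictMono_vec3_iff₃₇ _).2 u.2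
  have hFinj : ∀ k, Injective (F k) := injective_word₃₇ e₀
  -- the letter sets
  have hcard : ∀ k, (Finset.univ.image (F k)).card = 3 := fun k ↦ by
    rw [Finset.card_image_of_injective _ (hFinj k), Finset.card_univ, Fintype.card_fin]
  let Θ : ({u : Fin 3 → Fin (j + 3) ⊕ Fin (j + 3) // Sum.elim id id (u 0) < Sum.elim id id (u 1) ∧ Sum.elim id id (u 1) < Sum.elim id id (u 2)} ⊕ Fin (j + 2) × (Fin (j + 3) ⊕ Fin (j + 3))) → Set.powersetCard ι 3 := fun k ↦ Set.powersetCard.ofCard (hcard k)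
  have hΘ : ∀ k b, b ∈ Θ k ↔ b ∈ Set.range (F k) := fun k b ↦ by
    change b ∈ Finset.univ.image (F k) ↔ _
    simp [Finset.mem_image]
  have key : ∀ k k', Θ k = Θ k' → Set.range (F k) = Set.range (F k') := fun k k' h ↦ Set.ext fun b ↦ by
    rw [← hΘ, ← hΘ, h]
  have hΘinj : Injective Θ := by
    rintro (u | ⟨k, x⟩) (u' | ⟨k', x'⟩) h <;> have hr := key _ _ h
    · rw [hFl, hFl, Set.range_comp, Set.range_comp, Set.image_eq_image e₀.injective] at hr
      exact congrArg Sum.inl (Subtype.ext (eq_of_range_eq_of_strictMono_index₃₇ (hmono u) (hmono u') hr))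
    · rw [hFl, hFr, Set.range_comp, Set.range_comp, Set.image_eq_image e₀.injective] at hr
      exact absurd hr (range_ne_range_pairWord₃₇ (hmono u) _ _)
    · rw [hFr, hFl, Set.range_comp, Set.range_comp, Set.image_eq_image e₀.injective] at hr
      exact absurd hr.symm (range_ne_range_pairWord₃₇ (hmono u') _ _)
    · rw [hFr, hFr, Set.range_comp, Set.range_comp, Set.image_eq_image e₀.injective] at hr
      obtain ⟨hi, hx⟩ := eq_of_range_pairWord_eq₃₇ (Fin.succAbove_ne _ k) (Fin.succAbove_ne _ k') hr
      subst hx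
      rw [Fin.succAbove_right_injective hi]
  have hΘsurj : Surjective Θ := fun R ↦ by
    set w := (strictMonoEquivPowersetCard ι 3).symm R with hw
    have hz : Injective (⇑e₀.symm ∘ w.1) := e₀.symm.injective.comp w.2.injective
    have hR : ∀ k, Set.range (F k) = Set.range w.1 → Θ k = R := fun k hk ↦ by
      refine SetLike.ext fun b ↦ ?_
      rw [hΘ, hk, hw, mem_range_strictMonoEquivPowersetCard_symm_iff₃₇]
    have hback : ∀ v : Fin 3 → Fin (j + 3) ⊕ Fin (j + 3), Set.range v = Set.range (⇑e₀.symm ∘ w.1) →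
        Set.range (⇑e₀ ∘ v) = Set.range w.1 := fun v hv ↦ by
      rw [Set.range_comp, hv, ← Set.range_comp, ← Function.comp_assoc, Equiv.self_comp_symm, Function.id_comp]
    rcases exists_range_eq₃₇ (⇑e₀.symm ∘ w.1) hz with ⟨u, hu, hru⟩ | ⟨x, k, hrx⟩
    · exact ⟨Sum.inl ⟨u, (strictMono_vec3_iff₃₇ _).1 hu⟩, hR _ (by rw [hFl]; exact hback u hru)⟩
    · exact ⟨Sum.inr (k, x), hR _ (by rw [hFr]; exact hback _ hrx)⟩
  refine ⟨(Equiv.ofBijective Θ ⟨hΘinj, hΘsurj⟩).trans (strictMonoEquivPowersetCard ι 3).symm, fun k ↦ Set.ext fun b ↦ ?_⟩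
  rw [← hΘ]
  exact (mem_range_strictMonoEquivPowersetCard_symm_iff₃₇ (Θ k) b).symm

omit [DecidableEq ι] in
/-- **The `ℤ`-basis of `H³(X, ℤ)` indexed by the free-letter datum**: `dx_{(x_a, x_b, x_c)}` (`a < b < c`) and
`dx_{(λ_i, μ_i, x)}`, `i = s_{a(x)}(k)` — the tree's increasing-monomial basis `intLatMonomialBasis` up to order and sign.
[cite: Lange2023AbelianVarietiesComplex, §1.1.3 Exercise 1.1.6 (8); §1.1.4 Prop. 1.1.20] -/
theorem exists_basis_integralForms_three_freeLetter [LinearOrder ι] (e₀ : Fin (j + 3) ⊕ Fin (j + 3) ≃ ι) :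
    ∃ b : Basis ({u : Fin 3 → Fin (j + 3) ⊕ Fin (j + 3) // Sum.elim id id (u 0) < Sum.elim id id (u 1) ∧ Sum.elim id id (u 1) < Sum.elim id id (u 2)} ⊕ Fin (j + 2) × (Fin (j + 3) ⊕ Fin (j + 3))) ℤ ↥(AddSubgroup.toIntSubmodule (integralForms Φ 3)),
      (∀ u, ((b (Sum.inl u) : ↥(AddSubgroup.toIntSubmodule (integralForms Φ 3))) : E [⋀^Fin 3]→L[ℝ] ℂ) =
          latMonomial Φ 3 (⇑e₀ ∘ u.1)) ∧
      ∀ k x, ((b (Sum.inr (k, x)) : ↥(AddSubgroup.toIntSubmodule (integralForms Φ 3))) : E [⋀^Fin 3]→L[ℝ] ℂ) =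
          latMonomial Φ 3 ![e₀ (Sum.inl ((Sum.elim id id x).succAbove k)), e₀ (Sum.inr ((Sum.elim id id x).succAbove k)),
            e₀ x] := by
  classical
  obtain ⟨ψ, hψ⟩ := exists_equiv_range_word_eq₃₇ (j := j) e₀
  choose ε hε using fun k ↦ exists_latMonomial_eq_units_smul_of_range_eq Φ (injective_word₃₇ e₀ k) (ψ k) (hψ k)
  refine ⟨((intLatMonomialBasis Φ 3).reindex ψ.symm).unitsSMul ε, fun u ↦ ?_, fun k x ↦ ?_⟩
  · have h1 := hε (Sum.inl u)
    change latMonomial Φ 3 (⇑e₀ ∘ u.1) = _ at h1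
    rw [Basis.unitsSMul_apply, Basis.reindex_apply, Equiv.symm_symm, Units.smul_def, Submodule.coe_smul,
      coe_intLatMonomialBasis, ← Int.cast_smul_eq_zsmul ℂ (ε (Sum.inl u) : ℤ) (latMonomial Φ 3 (ψ (Sum.inl u)).1), ← h1]
  · have h1 := hε (Sum.inr (k, x))
    change latMonomial Φ 3 ![e₀ (Sum.inl ((Sum.elim id id x).succAbove k)), e₀ (Sum.inr ((Sum.elim id id x).succAbove k)),
      e₀ x] = _ at h1
    rw [Basis.unitsSMul_apply, Basis.reindex_apply, Equiv.symm_symm, Units.smul_def, Submodule.coe_smul,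
      coe_intLatMonomialBasis, ← Int.cast_smul_eq_zsmul ℂ (ε (Sum.inr (k, x)) : ℤ) (latMonomial Φ 3 (ψ (Sum.inr (k, x))).1),
      ← h1]


/-! ### The target words `(λμ)_T ++ (x_a, x_b, x_c)` (`T = {a,b,c}ᶜ`) and `(λμ)_{T'} ++ (x)` (`T' = {a(x), i'}ᶜ`) -/

section TargetWords

variable {g : ℕ} (e₁ : Fin g ⊕ Fin g ≃ ι)

omit [Fintype ι] [DecidableEq ι] in
/-- The letters of `(λμ)_T ++ (x_a, x_b, x_c)`, `T = {a, b, c}ᶜ`, are all letters except the partners `x̄_a, x̄_b, x̄_c`.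
[cite: Lange2023AbelianVarietiesComplex, §2.5.3 Thm. 2.5.16 (PDF p. 135)] -/
theorem range_append_ilvWord_three_free {q : ℕ} (u : Fin 3 → Fin g ⊕ Fin g) (hu : StrictMono fun m ↦ Sum.elim id id (u m))
    (T : Set.powersetCard (Fin g) q) (hT : (T : Finset (Fin g)) = (Finset.univ.image fun m ↦ Sum.elim id id (u m))ᶜ) :
    Set.range (Fin.append (ilvWord e₁ (Set.powersetCard.ofFinEmbEquiv.symm T)) (⇑e₁ ∘ u)) =
      (Set.range (⇑e₁ ∘ Sum.swap ∘ u))ᶜ := by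
  classical
  ext b
  obtain ⟨z, rfl⟩ : ∃ z, b = e₁ z := ⟨e₁.symm b, (e₁.apply_symm_apply b).symm⟩
  have hr : ∀ v : Fin 3 → Fin g ⊕ Fin g, e₁ z ∈ Set.range (⇑e₁ ∘ v) ↔ z ∈ Set.range v := fun v ↦ by
    rw [Set.range_comp, e₁.injective.mem_set_image]
  rw [mem_range_append_iff₃₇, apply_mem_range_ilvWord_iff, Set.powersetCard.mem_range_ofFinEmbEquiv_symm_iff_mem,
    ← Set.powersetCard.mem_coe_iff, hT, Finset.mem_compl, Finset.mem_image, Set.mem_compl_iff, hr u,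
    show (⇑e₁ ∘ Sum.swap ∘ u) = ⇑e₁ ∘ (Sum.swap ∘ u) from rfl, hr (Sum.swap ∘ u)]
  constructor
  · rintro (h1 | ⟨m, rfl⟩) ⟨m', hm'⟩
    · exact h1 ⟨m', Finset.mem_univ _, by rw [← hm']; exact (index_swap₃₇ (u m')).symm⟩
    · have hmm : m' = m := hu.injective (by
        rw [← hm']
        exact (index_swap₃₇ (u m')).symm)
      rw [hmm] at hm'
      exact swap_ne_self₃₇ (u m) hm'
  · intro h1
    by_cases h2 : ∃ m ∈ (Finset.univ : Finset (Fin 3)), Sum.elim id id (u m) = Sum.elim id id z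
    · obtain ⟨m, -, hm⟩ := h2
      rcases eq_or_eq_swap_of_index_eq₃₇ hm.symm with h3 | h3
      · exact Or.inr ⟨m, h3.symm⟩
      · exact absurd ⟨m, h3.symm⟩ h1
    · exact Or.inl h2

omit [Fintype ι] [DecidableEq ι] in
/-- `(λμ)_T ++ (x_a, x_b, x_c)` (`T = {a, b, c}ᶜ`) is injective. [cite: Lange2023AbelianVarietiesComplex, §2.5.3 Thm. 2.5.16 (PDF p. 135)] -/
theorem injective_append_ilvWord_three_free {q : ℕ} (u : Fin 3 → Fin g ⊕ Fin g)
    (hu : StrictMono fun m ↦ Sum.elim id id (u m)) (T : Set.powersetCard (Fin g) q)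
    (hT : (T : Finset (Fin g)) = (Finset.univ.image fun m ↦ Sum.elim id id (u m))ᶜ) :
    Injective (Fin.append (ilvWord e₁ (Set.powersetCard.ofFinEmbEquiv.symm T)) (⇑e₁ ∘ u)) := by
  classical
  refine Fin.append_injective_iff.2 ⟨ilvWord_injective e₁ (Set.powersetCard.ofFinEmbEquiv.symm T).injective,
    e₁.injective.comp (show Injective (Sum.elim id id ∘ u) from hu.injective).of_comp, fun m p hmp ↦ ?_⟩
  have h1 : Sum.elim id id (u p) ∈ Set.range ⇑(Set.powersetCard.ofFinEmbEquiv.symm T) :=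
    (apply_mem_range_ilvWord_iff e₁ _ (u p)).1 ⟨m, hmp⟩
  rw [Set.powersetCard.mem_range_ofFinEmbEquiv_symm_iff_mem, ← Set.powersetCard.mem_coe_iff, hT, Finset.mem_compl] at h1
  exact h1 (Finset.mem_image_of_mem _ (Finset.mem_univ p))

end TargetWords

omit [Fintype ι] [DecidableEq ι] in
/-- The letters of `(λμ)_{T'} ++ (x)`, `T' = {a(x), i'}ᶜ`, are all letters except `λ_{i'}, μ_{i'}, x̄`.
[cite: Lange2023AbelianVarietiesComplex, §2.5.3 Thm. 2.5.16 (PDF p. 135)] -/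
theorem range_append_ilvWord_pair (e₀ : Fin (j + 3) ⊕ Fin (j + 3) ≃ ι) (x : Fin (j + 3) ⊕ Fin (j + 3)) (k' : Fin (j + 2))
    (T' : Set.powersetCard (Fin (j + 3)) (j + 1))
    (hT' : (T' : Finset (Fin (j + 3))) = ({Sum.elim id id x, (Sum.elim id id x).succAbove k'} : Finset (Fin (j + 3)))ᶜ)
    (hc : 2 * j + 3 = 2 * (j + 1) + 1) :
    Set.range ((Fin.append (ilvWord e₀ (Set.powersetCard.ofFinEmbEquiv.symm T')) (fun _ : Fin 1 ↦ e₀ x)) ∘ Fin.cast hc) =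
      (Set.range ![e₀ (Sum.inl ((Sum.elim id id x).succAbove k')), e₀ (Sum.inr ((Sum.elim id id x).succAbove k')),
        e₀ x.swap])ᶜ := by
  classical
  have hsurj : Surjective (Fin.cast hc) := fun i ↦ ⟨Fin.cast hc.symm i, Fin.ext rfl⟩
  rw [hsurj.range_comp]
  ext b
  obtain ⟨z, rfl⟩ : ∃ z, b = e₀ z := ⟨e₀.symm b, (e₀.apply_symm_apply b).symm⟩
  have h1 : e₀ z ∈ Set.range (fun _ : Fin 1 ↦ e₀ x) ↔ z = x := by
    constructor
    · rintro ⟨_, h⟩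
      exact (e₀.injective h).symm
    · rintro rfl
      exact ⟨0, rfl⟩
  rw [mem_range_append_iff₃₇, apply_mem_range_ilvWord_iff, Set.powersetCard.mem_range_ofFinEmbEquiv_symm_iff_mem,
    ← Set.powersetCard.mem_coe_iff, hT', Finset.mem_compl, Finset.mem_insert, Finset.mem_singleton, Set.mem_compl_iff,
    mem_range_vec3_iff₃₇, e₀.apply_eq_iff_eq, e₀.apply_eq_iff_eq, e₀.apply_eq_iff_eq, h1]
  constructor
  · rintro (h2 | rfl)
    · rintro (rfl | rfl | rfl)
      · exact h2 (Or.inr rfl)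
      · exact h2 (Or.inr rfl)
      · exact h2 (Or.inl (index_swap₃₇ x))
    · rintro (h3 | h3 | h3)
      · exact Fin.succAbove_ne (Sum.elim id id z) k' (congrArg (Sum.elim id id) h3).symm
      · exact Fin.succAbove_ne (Sum.elim id id z) k' (congrArg (Sum.elim id id) h3).symm
      · exact swap_ne_self₃₇ z h3.symm
  · intro h2
    by_cases hzx : z = x
    · exact Or.inr hzx
    · refine Or.inl ?_
      rintro (h3 | h3)
      · rcases eq_or_eq_swap_of_index_eq₃₇ h3 with h4 | h4
        · exact hzx h4
        · exact h2 (Or.inr (Or.inr h4))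
      · rcases eq_inl_or_eq_inr₃₇ z with h4 | h4
        · exact h2 (Or.inl (by rw [h4, h3]))
        · exact h2 (Or.inr (Or.inl (by rw [h4, h3])))

omit [Fintype ι] [DecidableEq ι] in
/-- `(λμ)_{T'} ++ (x)` (`T' = {a(x), i'}ᶜ`) is injective. [cite: Lange2023AbelianVarietiesComplex, §2.5.3 Thm. 2.5.16 (PDF p. 135)] -/
theorem injective_append_ilvWord_pair (e₀ : Fin (j + 3) ⊕ Fin (j + 3) ≃ ι) (x : Fin (j + 3) ⊕ Fin (j + 3)) (k' : Fin (j + 2))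
    (T' : Set.powersetCard (Fin (j + 3)) (j + 1))
    (hT' : (T' : Finset (Fin (j + 3))) = ({Sum.elim id id x, (Sum.elim id id x).succAbove k'} : Finset (Fin (j + 3)))ᶜ)
    (hc : 2 * j + 3 = 2 * (j + 1) + 1) :
    Injective ((Fin.append (ilvWord e₀ (Set.powersetCard.ofFinEmbEquiv.symm T')) (fun _ : Fin 1 ↦ e₀ x)) ∘ Fin.cast hc) := by
  classical
  refine Injective.comp ?_ (Fin.cast_injective hc)
  refine Fin.append_injective_iff.2 ⟨ilvWord_injective e₀ (Set.powersetCard.ofFinEmbEquiv.symm T').injective,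
    injective_of_subsingleton _, fun m p hmp ↦ ?_⟩
  have h1 : Sum.elim id id x ∈ Set.range ⇑(Set.powersetCard.ofFinEmbEquiv.symm T') :=
    (apply_mem_range_ilvWord_iff e₀ _ x).1 ⟨m, hmp⟩
  rw [Set.powersetCard.mem_range_ofFinEmbEquiv_symm_iff_mem, ← Set.powersetCard.mem_coe_iff, hT', Finset.mem_compl,
    Finset.mem_insert] at h1
  exact h1 (Or.inl rfl)

omit [DecidableEq ι] in
/-- **The `ℤ`-basis of `H^{2g−3}(X, ℤ)` indexed by the free-letter datum** (`g = j + 3`): `dx_{(λμ)_{{a,b,c}ᶜ} ++ (x_a, x_b, x_c)}`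
for `(x_a, x_b, x_c) ∈ A` and `dx_{(λμ)_{{a(x), s_{a(x)}(k)}ᶜ} ++ (x)}` for `(k, x)` — these words carry all letters except three
(the partners `x̄_a, x̄_b, x̄_c`, resp. `λ_i, μ_i, x̄`), every co-three letter set exactly once, so they are the increasing-monomial
basis `intLatMonomialBasis` of `H^{2g−3}(X, ℤ)` up to order and sign. The interleaved blocks are taken along any chosen sets
`T(u) = {a,b,c}ᶜ`, `T'(x, k) = {a(x), s_{a(x)}(k)}ᶜ`. [cite: Lange2023AbelianVarietiesComplex, §1.1.3 Exercise 1.1.6 (8); §2.5.3 Thm. 2.5.16 (PDF p. 135)] -/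
theorem exists_basis_integralForms_coe_eq_append_ilvWord_freeLetter [LinearOrder ι] (e₀ : Fin (j + 3) ⊕ Fin (j + 3) ≃ ι)
    (hkl : (2 * j + 3) + 3 = Fintype.card ι)
    (T : {u : Fin 3 → Fin (j + 3) ⊕ Fin (j + 3) // Sum.elim id id (u 0) < Sum.elim id id (u 1) ∧ Sum.elim id id (u 1) < Sum.elim id id (u 2)} → Set.powersetCard (Fin (j + 3)) j)
    (hT : ∀ u, (T u : Finset (Fin (j + 3))) = (Finset.univ.image fun m ↦ Sum.elim id id (u.1 m))ᶜ)
    (T' : Fin (j + 3) ⊕ Fin (j + 3) → Fin (j + 2) → Set.powersetCard (Fin (j + 3)) (j + 1))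
    (hT' : ∀ x k, (T' x k : Finset (Fin (j + 3))) = ({Sum.elim id id x, (Sum.elim id id x).succAbove k} : Finset (Fin (j + 3)))ᶜ)
    (hc : 2 * j + 3 = 2 * (j + 1) + 1) :
    ∃ b : Basis ({u : Fin 3 → Fin (j + 3) ⊕ Fin (j + 3) // Sum.elim id id (u 0) < Sum.elim id id (u 1) ∧ Sum.elim id id (u 1) < Sum.elim id id (u 2)} ⊕ Fin (j + 2) × (Fin (j + 3) ⊕ Fin (j + 3))) ℤ ↥(AddSubgroup.toIntSubmodule (integralForms Φ (2 * j + 3))),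
      (∀ u, ((b (Sum.inl u) : ↥(AddSubgroup.toIntSubmodule (integralForms Φ (2 * j + 3)))) : E [⋀^Fin (2 * j + 3)]→L[ℝ] ℂ) =
          latMonomial Φ (2 * j + 3) (Fin.append (ilvWord e₀ (Set.powersetCard.ofFinEmbEquiv.symm (T u))) (⇑e₀ ∘ u.1))) ∧
      ∀ k x, ((b (Sum.inr (k, x)) : ↥(AddSubgroup.toIntSubmodule (integralForms Φ (2 * j + 3)))) :
            E [⋀^Fin (2 * j + 3)]→L[ℝ] ℂ) =
          latMonomial Φ (2 * j + 3)
            ((Fin.append (ilvWord e₀ (Set.powersetCard.ofFinEmbEquiv.symm (T' x k))) (fun _ : Fin 1 ↦ e₀ x)) ∘ Fin.cast hc) := by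
  classical
  obtain ⟨ψ, hψ⟩ := exists_equiv_range_word_eq₃₇ (j := j) e₀
  have hmono : ∀ u : {u : Fin 3 → Fin (j + 3) ⊕ Fin (j + 3) // Sum.elim id id (u 0) < Sum.elim id id (u 1) ∧ Sum.elim id id (u 1) < Sum.elim id id (u 2)},
      StrictMono fun m ↦ Sum.elim id id (u.1 m) := fun u ↦ (strictMono_vec3_iff₃₇ _).2 u.2
  -- the target words
  let G : ({u : Fin 3 → Fin (j + 3) ⊕ Fin (j + 3) // Sum.elim id id (u 0) < Sum.elim id id (u 1) ∧ Sum.elim id id (u 1) < Sum.elim id id (u 2)} ⊕ Fin (j + 2) × (Fin (j + 3) ⊕ Fin (j + 3))) → Fin (2 * j + 3) → ι :=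
    Sum.elim (fun u ↦ Fin.append (ilvWord e₀ (Set.powersetCard.ofFinEmbEquiv.symm (T u))) (⇑e₀ ∘ u.1))
      (fun p ↦ (Fin.append (ilvWord e₀ (Set.powersetCard.ofFinEmbEquiv.symm (T' p.2 p.1))) (fun _ : Fin 1 ↦ e₀ p.2)) ∘
        Fin.cast hc)
  have hGinj : ∀ k, Injective (G k) := by
    rintro (u | ⟨k, x⟩)
    · exact injective_append_ilvWord_three_free e₀ u.1 (hmono u) (T u) (hT u)
    · exact injective_append_ilvWord_pair e₀ x k (T' x k) (hT' x k) hc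
  -- the partner involution `τ` of the index type: `(x_a, x_b, x_c) ↦ (x̄_a, x̄_b, x̄_c)`, `(λ_i, μ_i, x) ↦ (λ_i, μ_i, x̄)`
  have hswapmono : ∀ u : {u : Fin 3 → Fin (j + 3) ⊕ Fin (j + 3) // Sum.elim id id (u 0) < Sum.elim id id (u 1) ∧ Sum.elim id id (u 1) < Sum.elim id id (u 2)},
      Sum.elim id id ((Sum.swap ∘ u.1) 0) < Sum.elim id id ((Sum.swap ∘ u.1) 1) ∧
        Sum.elim id id ((Sum.swap ∘ u.1) 1) < Sum.elim id id ((Sum.swap ∘ u.1) 2) := fun u ↦ by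
    simp only [comp_apply, index_swap₃₇]
    exact u.2
  let τ : ({u : Fin 3 → Fin (j + 3) ⊕ Fin (j + 3) // Sum.elim id id (u 0) < Sum.elim id id (u 1) ∧ Sum.elim id id (u 1) < Sum.elim id id (u 2)} ⊕ Fin (j + 2) × (Fin (j + 3) ⊕ Fin (j + 3))) → ({u : Fin 3 → Fin (j + 3) ⊕ Fin (j + 3) // Sum.elim id id (u 0) < Sum.elim id id (u 1) ∧ Sum.elim id id (u 1) < Sum.elim id id (u 2)} ⊕ Fin (j + 2) × (Fin (j + 3) ⊕ Fin (j + 3))) :=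
    Sum.map (fun u ↦ ⟨Sum.swap ∘ u.1, hswapmono u⟩) (fun p ↦ (p.1, p.2.swap))
  have hτ : Function.Involutive τ := by
    rintro (u | ⟨k, x⟩)
    · exact congrArg Sum.inl (Subtype.ext (funext fun m ↦ Sum.swap_swap (u.1 m)))
    · exact congrArg Sum.inr (Prod.ext rfl (Sum.swap_swap x))
  -- the letters of `G k` are the letters missing from the word of `τ k`
  have hGrange : ∀ k, Set.range (G k) = (Set.range (Sum.elim (fun u : {u : Fin 3 → Fin (j + 3) ⊕ Fin (j + 3) // Sum.elim id id (u 0) < Sum.elim id id (u 1) ∧ Sum.elim id id (u 1) < Sum.elim id id (u 2)} ↦ ⇑e₀ ∘ u.1)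
        (fun p : Fin (j + 2) × (Fin (j + 3) ⊕ Fin (j + 3)) ↦ ![e₀ (Sum.inl ((Sum.elim id id p.2).succAbove p.1)),
          e₀ (Sum.inr ((Sum.elim id id p.2).succAbove p.1)), e₀ p.2]) (τ k)))ᶜ := by
    rintro (u | ⟨k, x⟩)
    · exact range_append_ilvWord_three_free e₀ u.1 (hmono u) (T u) (hT u)
    · change Set.range ((Fin.append (ilvWord e₀ (Set.powersetCard.ofFinEmbEquiv.symm (T' x k))) (fun _ : Fin 1 ↦ e₀ x)) ∘
          Fin.cast hc) = (Set.range ![e₀ (Sum.inl ((Sum.elim id id x.swap).succAbove k)),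
            e₀ (Sum.inr ((Sum.elim id id x.swap).succAbove k)), e₀ x.swap])ᶜ
      rw [index_swap₃₇]
      exact range_append_ilvWord_pair e₀ x k (T' x k) (hT' x k) hc
  let ψ₂ : ({u : Fin 3 → Fin (j + 3) ⊕ Fin (j + 3) // Sum.elim id id (u 0) < Sum.elim id id (u 1) ∧ Sum.elim id id (u 1) < Sum.elim id id (u 2)} ⊕ Fin (j + 2) × (Fin (j + 3) ⊕ Fin (j + 3))) ≃ {w : Fin (2 * j + 3) → ι // StrictMono w} :=
    (hτ.toPerm τ).trans (ψ.trans (complWord hkl))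
  have hψ₂ : ∀ k, Set.range (G k) = Set.range (ψ₂ k).1 := fun k ↦ by
    rw [hGrange k, hψ (τ k)]
    ext b
    rw [Set.mem_compl_iff]
    exact (mem_range_complWord_iff hkl (ψ (τ k)) b).symm
  choose ε hε using fun k ↦ exists_latMonomial_eq_units_smul_of_range_eq Φ (hGinj k) (ψ₂ k) (hψ₂ k)
  refine ⟨((intLatMonomialBasis Φ (2 * j + 3)).reindex ψ₂.symm).unitsSMul ε, fun u ↦ ?_, fun k x ↦ ?_⟩
  · have h1 := hε (Sum.inl u)
    change latMonomial Φ (2 * j + 3) (Fin.append (ilvWord e₀ (Set.powersetCard.ofFinEmbEquiv.symm (T u))) (⇑e₀ ∘ u.1)) = _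
      at h1
    rw [Basis.unitsSMul_apply, Basis.reindex_apply, Equiv.symm_symm, Units.smul_def, Submodule.coe_smul,
      coe_intLatMonomialBasis, ← Int.cast_smul_eq_zsmul ℂ (ε (Sum.inl u) : ℤ) (latMonomial Φ (2 * j + 3) (ψ₂ (Sum.inl u)).1),
      ← h1]
  · have h1 := hε (Sum.inr (k, x))
    change latMonomial Φ (2 * j + 3) ((Fin.append (ilvWord e₀ (Set.powersetCard.ofFinEmbEquiv.symm (T' x k)))
      (fun _ : Fin 1 ↦ e₀ x)) ∘ Fin.cast hc) = _ at h1
    rw [Basis.unitsSMul_apply, Basis.reindex_apply, Equiv.symm_symm, Units.smul_def, Submodule.coe_smul,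
      coe_intLatMonomialBasis,
      ← Int.cast_smul_eq_zsmul ℂ (ε (Sum.inr (k, x)) : ℤ) (latMonomial Φ (2 * j + 3) (ψ₂ (Sum.inr (k, x))).1), ← h1]


/-! ## §5 The pair blocks: `|det B_x| = ((g−3)!)^{g−1} · (∏_{ν ≠ a(x)} d_ν)^{g−3} · (g−2)` -/

/-- `det (1 − J) = 1 − n` for the all-ones `n × n` matrix `J` (matrix determinant lemma; as in g35-#3 §4). [folklore] -/
private theorem det_one_sub_of_one₃₇ (n : ℕ) :
    ((1 : Matrix (Fin n) (Fin n) ℤ) - Matrix.of (fun _ _ ↦ (1 : ℤ))).det = 1 - (n : ℤ) := by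
  have h : (1 : Matrix (Fin n) (Fin n) ℤ) - Matrix.of (fun _ _ ↦ (1 : ℤ)) =
      1 + Matrix.replicateCol (Fin 1) (fun _ ↦ (-1 : ℤ)) * Matrix.replicateRow (Fin 1) (fun _ ↦ (1 : ℤ)) := by
    ext i k
    simp [Matrix.replicateCol, Matrix.replicateRow, Matrix.mul_apply, sub_eq_add_neg]
  rw [h, Matrix.det_one_add_mul_comm, Matrix.det_unique]
  simp [Matrix.mul_apply]
  ring

/-- **`|det (J − 1)| = g − 2`** for the `(g−1) × (g−1)` matrix with `0` on and `1` off the diagonal (`g = j + 3`). [folklore] -/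
private theorem natAbs_det_of_ite₃₇ (j : ℕ) :
    (Matrix.of (fun b a : Fin (j + 2) ↦ if b = a then (0 : ℤ) else 1)).det.natAbs = j + 1 := by
  have h : Matrix.of (fun b a : Fin (j + 2) ↦ if b = a then (0 : ℤ) else 1) =
      -((1 : Matrix (Fin (j + 2)) (Fin (j + 2)) ℤ) - Matrix.of (fun _ _ ↦ (1 : ℤ))) := by
    ext b a
    by_cases hba : b = a <;> simp [hba]
  rw [h, Matrix.det_neg, det_one_sub_of_one₃₇, Int.natAbs_mul, Int.natAbs_pow, Int.natAbs_neg, Int.natAbs_one, one_pow,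
    one_mul]
  omega

/-- `(∏_{ν ∉ {a, s_a(k), s_a(k')}} d_ν) · d_{s_a(k)} · d_{s_a(k')} = ∏_{ν ≠ a} d_ν` for `k ≠ k'`. [folklore] -/
private theorem prod_compl_triple_mul₃₇ (d : Fin (j + 3) → ℕ) (a : Fin (j + 3)) {k k' : Fin (j + 2)} (hk : k' ≠ k) :
    (∏ ν ∈ ({a, a.succAbove k, a.succAbove k'} : Finset (Fin (j + 3)))ᶜ, d ν) * (d (a.succAbove k) * d (a.succAbove k')) =
      ∏ ν ∈ ({a} : Finset (Fin (j + 3)))ᶜ, d ν := by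
  have h1 : a.succAbove k ∈ ({a} : Finset (Fin (j + 3)))ᶜ := by
    rw [Finset.mem_compl, Finset.mem_singleton]
    exact Fin.succAbove_ne a k
  have h2 : a.succAbove k' ∈ (({a} : Finset (Fin (j + 3)))ᶜ).erase (a.succAbove k) := by
    rw [Finset.mem_erase, Finset.mem_compl, Finset.mem_singleton]
    exact ⟨Fin.succAbove_right_injective.ne hk, Fin.succAbove_ne a k'⟩
  have h3 : ((({a} : Finset (Fin (j + 3)))ᶜ).erase (a.succAbove k)).erase (a.succAbove k') =
      ({a, a.succAbove k, a.succAbove k'} : Finset (Fin (j + 3)))ᶜ := by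
    ext ν
    simp only [Finset.mem_erase, Finset.mem_compl, Finset.mem_insert, Finset.mem_singleton, not_or]
    tauto
  rw [← Finset.mul_prod_erase _ d h1, ← Finset.mul_prod_erase _ d h2, h3]
  ring

/-- **The pair block and its determinant**: for `B = ((g−3)! · [k' ≠ k] · ∏_{ν ∉ {a, s_a(k), s_a(k')}} d_ν)_{k', k}` (`g = j + 3`,
`s_a = Fin.succAbove a`), `diag(d ∘ s_a) · B · diag(d ∘ s_a) = (g−3)! (∏_{ν ≠ a} d_ν) · (J − 1)`, hence
`|det B| = ((g−3)!)^{g−1} · (∏_{ν ≠ a} d_ν)^{g−3} · (g−2)`. [folklore] -/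
private theorem natAbs_det_pairBlock₃₇ (d : Fin (j + 3) → ℕ) (hd : ∀ ν, 0 < d ν) (a : Fin (j + 3)) :
    (Matrix.of fun k' k : Fin (j + 2) ↦ if k' = k then (0 : ℤ) else
        ((j.factorial * ∏ ν ∈ ({a, a.succAbove k, a.succAbove k'} : Finset (Fin (j + 3)))ᶜ, d ν : ℕ) : ℤ)).det.natAbs =
      j.factorial ^ (j + 2) * (∏ ν ∈ ({a} : Finset (Fin (j + 3)))ᶜ, d ν) ^ j * (j + 1) := by
  set P : ℕ := ∏ ν ∈ ({a} : Finset (Fin (j + 3)))ᶜ, d ν with hP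
  set C : Matrix (Fin (j + 2)) (Fin (j + 2)) ℤ := Matrix.of fun k' k : Fin (j + 2) ↦ if k' = k then (0 : ℤ) else
    ((j.factorial * ∏ ν ∈ ({a, a.succAbove k, a.succAbove k'} : Finset (Fin (j + 3)))ᶜ, d ν : ℕ) : ℤ) with hC
  have hCapply : ∀ k' k, C k' k = if k' = k then (0 : ℤ) else
      ((j.factorial * ∏ ν ∈ ({a, a.succAbove k, a.succAbove k'} : Finset (Fin (j + 3)))ᶜ, d ν : ℕ) : ℤ) := fun _ _ ↦ rfl
  -- `diag(d ∘ s) · C · diag(d ∘ s) = ((g−3)! P) • (J − 1)`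
  have hscale : Matrix.diagonal (fun k ↦ (d (a.succAbove k) : ℤ)) * C * Matrix.diagonal (fun k ↦ (d (a.succAbove k) : ℤ)) =
      ((j.factorial * P : ℕ) : ℤ) • Matrix.of (fun k' k : Fin (j + 2) ↦ if k' = k then (0 : ℤ) else 1) := by
    ext k' k
    rw [Matrix.mul_diagonal, Matrix.diagonal_mul, Matrix.smul_apply, Matrix.of_apply, hCapply, smul_eq_mul]
    by_cases hkk : k' = k
    · rw [if_pos hkk, if_pos hkk, mul_zero, zero_mul, mul_zero]
    · rw [if_neg hkk, if_neg hkk, mul_one, hP, ← prod_compl_triple_mul₃₇ d a hkk]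
      push_cast
      ring
  have hprod : ∏ k : Fin (j + 2), d (a.succAbove k) = P := by
    have h1 := Fin.prod_univ_succAbove d a
    have h2 : ∏ ν, d ν = d a * P := by
      rw [hP, Finset.compl_singleton, Finset.mul_prod_erase _ d (Finset.mem_univ a)]
    exact Nat.eq_of_mul_eq_mul_left (hd a) (h1.symm.trans h2)
  have hdet := congrArg Matrix.det hscale
  rw [Matrix.det_mul, Matrix.det_mul, Matrix.det_diagonal, Matrix.det_smul, Fintype.card_fin, ← Nat.cast_prod, hprod] at hdet
  have hPpos : 0 < P := Finset.prod_pos fun ν _ ↦ hd ν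
  have h3 := congrArg Int.natAbs hdet
  rw [Int.natAbs_mul, Int.natAbs_mul, Int.natAbs_natCast, Int.natAbs_mul, Int.natAbs_pow, Int.natAbs_natCast,
    natAbs_det_of_ite₃₇] at h3
  have h4 : P * P * C.det.natAbs = P * P * (j.factorial ^ (j + 2) * P ^ j * (j + 1)) := by
    rw [show P * P * C.det.natAbs = P * C.det.natAbs * P by ring, h3]
    ring
  exact Nat.eq_of_mul_eq_mul_left (Nat.mul_pos hPpos hPpos) h4

/-! ## §6 The exact index `[H^{2g−3}(X, ℤ) : θ^{g−3} ∧ H³(X, ℤ)]` -/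

/-- **Integral hard Lefschetz in degree three — the exact index.** For a Riemann form `η` on the complex torus `X = E/Φ(ℤ^ι)` with
a symplectic enumeration `e₀` of type `d = (d₁, …, d_g)` of the lattice basis (`g = j + 3`, `θ = ofRealForm η`), the image of the
Lefschetz map `L^{g−3} = θ^{∧j} ∧ (−) : H³(X, ℤ) → H^{2g−3}(X, ℤ)` has index

  `[H^{2g−3}(X, ℤ) : θ^{∧(g−3)} ∧ H³(X, ℤ)] = ∏_{(x_a,x_b,x_c), a<b<c} (g−3)! ∏_{ν ∉ {a,b,c}} d_ν · ∏_x ((g−3)!)^{g−1} (∏_{ν ≠ a(x)} d_ν)^{g−3} (g−2)`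

(first product over the words on three increasing indices — `8 C(g,3)` of them —, second over the `2g` letters `x`). Proof: in the
`ℤ`-bases of §4 the matrix of `L^{g−3}` is block diagonal (§2): `1 × 1` blocks `(g−3)! ∏_{ν ∉ {a,b,c}} d_ν` on the free words and,
for each free letter `x`, the pair block `B_x` of §5 on the words `(λ_i, μ_i, x)`, `i ≠ a(x)` — with all signs `+` because pairs
commute (§1); the index of a full-rank sublattice is `|det|` (`AddSubgroup.relIndex_eq_natAbs_det`). `L^{g−3}` is an isomorphism
over `ℚ` (hard Lefschetz) — over `ℤ` exactly up to this index; e.g. `2^8` for `θ ∧ (−) : H³ → H⁵` on a p.p. abelian fourfold.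
[cite: Lange2023AbelianVarietiesComplex, §5.4.1 Thm. 5.4.1 and (5.22) (PDF p. 275); §2.5.3 Lemma 2.5.14, Thm. 2.5.16, Cor. 2.5.17 (PDF p. 135); §1.1.3 Exercise 1.1.6 (8)] [cite: VoisinHodgeI2002, §6.2.3 Thm. 6.25 (PDF p. 125); §7.1.2 (PDF p. 134 L31)] -/
theorem IsSymplecticEnum.relIndex_map_wedgePow_wedge_integralForms_three_hardLefschetz (h : IsSymplecticEnum Φ e₀ η d)
    (hη : IsRiemannForm Φ η) :
    ((integralForms Φ 3).map (AddMonoidHom.mk'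
        (fun x : E [⋀^Fin 3]→L[ℝ] ℂ ↦ (wedgePow (ofRealForm η) j).wedge x)
        (ContinuousAlternatingMap.wedge_add_right _))).relIndex (integralForms Φ (2 * j + 3)) =
      (∏ u : {u : Fin 3 → Fin (j + 3) ⊕ Fin (j + 3) // Sum.elim id id (u 0) < Sum.elim id id (u 1) ∧ Sum.elim id id (u 1) < Sum.elim id id (u 2)},
          (j.factorial * ∏ ν ∈ (Finset.univ.image fun m ↦ Sum.elim id id (u.1 m))ᶜ, d ν)) *
        ∏ x : Fin (j + 3) ⊕ Fin (j + 3),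
          (j.factorial ^ (j + 2) * (∏ ν ∈ ({Sum.elim id id x} : Finset (Fin (j + 3)))ᶜ, d ν) ^ j * (j + 1)) := by
  classical
  set θ : E [⋀^Fin (2 * j)]→L[ℝ] ℂ := wedgePow (ofRealForm η) j with hθ
  set L : (E [⋀^Fin 3]→L[ℝ] ℂ) →+ (E [⋀^Fin (2 * j + 3)]→L[ℝ] ℂ) := AddMonoidHom.mk'
    (fun x : E [⋀^Fin 3]→L[ℝ] ℂ ↦ θ.wedge x) (ContinuousAlternatingMap.wedge_add_right _) with hL
  set S : AddSubgroup (E [⋀^Fin (2 * j + 3)]→L[ℝ] ℂ) := (integralForms Φ 3).map L with hS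
  have hn : 3 + (2 * j + 3) = 2 * (j + 3) := by ring
  have hkl : (2 * j + 3) + 3 = Fintype.card ι := lk_eq_card (ilvEnum e₀) hn
  have hc : 2 * j + 3 = 2 * (j + 1) + 1 := by ring
  letI : LinearOrder ι := linearOrderOfOrientation (ilvEnum e₀)
  have hSle : S ≤ integralForms Φ (2 * j + 3) := by
    rintro _ ⟨x, hx, rfl⟩
    exact wedgePow_wedge_mem_integralForms Φ hη.isNSForm j hx
  -- `L` is injective on `H³(X, ℤ)` (hard Lefschetz over `ℂ`, `3 + j = dim X`), so `H³(X, ℤ) ≃ S`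
  haveI := finiteDimensional_real Φ (ilvEnum e₀)
  haveI : FiniteDimensional ℂ E := Module.Finite.of_restrictScalars_finite ℝ ℂ E
  have hg : finrank ℂ E = j + 3 := finrank_eq_of_finTwoMulEquiv Φ (ilvEnum e₀)
  have hLinj : Injective L := fun x y hxy ↦
    wedgePow_wedge_injective (IsRiemannForm.exists_apply_ne_zero Φ hη) (k := 3) (j := j) (by rw [hg, add_comm]) hxy
  let L' : ↥(AddSubgroup.toIntSubmodule (integralForms Φ 3)) →ₗ[ℤ] ↥(AddSubgroup.toIntSubmodule S) :=
    (AddMonoidHom.mk' (fun x : ↥(AddSubgroup.toIntSubmodule (integralForms Φ 3)) ↦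
        (⟨L x.1, AddSubgroup.mem_map_of_mem L x.2⟩ : ↥(AddSubgroup.toIntSubmodule S)))
      (fun a b ↦ Subtype.ext (map_add L _ _))).toIntLinearMap
  have hL'bij : Bijective L' := by
    refine ⟨fun x y hxy ↦ Subtype.ext (hLinj (congrArg Subtype.val hxy)), ?_⟩
    rintro ⟨_, x, hx, rfl⟩
    exact ⟨⟨x, hx⟩, rfl⟩
  let eS : ↥(AddSubgroup.toIntSubmodule (integralForms Φ 3)) ≃ₗ[ℤ] ↥(AddSubgroup.toIntSubmodule S) :=
    LinearEquiv.ofBijective L' hL'bij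
  -- the interleaved blocks `T(u) = {a,b,c}ᶜ`, `T'(x, k) = {a(x), s_{a(x)}(k)}ᶜ`
  have hcardT : ∀ u : {u : Fin 3 → Fin (j + 3) ⊕ Fin (j + 3) // Sum.elim id id (u 0) < Sum.elim id id (u 1) ∧ Sum.elim id id (u 1) < Sum.elim id id (u 2)},
      ((Finset.univ.image fun m ↦ Sum.elim id id (u.1 m))ᶜ).card = j := fun u ↦ by
    rw [Finset.card_compl, Finset.card_image_of_injective _ ((strictMono_vec3_iff₃₇ _).2 u.2).injective, Finset.card_univ,
      Fintype.card_fin, Fintype.card_fin]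
    omega
  have hcardT' : ∀ (x : Fin (j + 3) ⊕ Fin (j + 3)) (k : Fin (j + 2)),
      (({Sum.elim id id x, (Sum.elim id id x).succAbove k} : Finset (Fin (j + 3)))ᶜ).card = j + 1 := fun x k ↦ by
    rw [Finset.card_compl, Finset.card_pair (Fin.succAbove_ne _ k).symm, Fintype.card_fin]
    omega
  let T : {u : Fin 3 → Fin (j + 3) ⊕ Fin (j + 3) // Sum.elim id id (u 0) < Sum.elim id id (u 1) ∧ Sum.elim id id (u 1) < Sum.elim id id (u 2)} → Set.powersetCard (Fin (j + 3)) j :=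
    fun u ↦ Set.powersetCard.ofCard (hcardT u)
  let T' : Fin (j + 3) ⊕ Fin (j + 3) → Fin (j + 2) → Set.powersetCard (Fin (j + 3)) (j + 1) :=
    fun x k ↦ Set.powersetCard.ofCard (hcardT' x k)
  -- the bases (§4) and the image basis of `S`
  obtain ⟨b₃, hb₃l, hb₃r⟩ := exists_basis_integralForms_three_freeLetter Φ e₀
  obtain ⟨b₂, hb₂l, hb₂r⟩ := exists_basis_integralForms_coe_eq_append_ilvWord_freeLetter Φ e₀ hkl T (fun _ ↦ rfl) T'
    (fun _ _ ↦ rfl) hc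
  let bS : Basis ({u : Fin 3 → Fin (j + 3) ⊕ Fin (j + 3) // Sum.elim id id (u 0) < Sum.elim id id (u 1) ∧ Sum.elim id id (u 1) < Sum.elim id id (u 2)} ⊕ Fin (j + 2) × (Fin (j + 3) ⊕ Fin (j + 3))) ℤ
      ↥(AddSubgroup.toIntSubmodule S) := b₃.map eS
  let v : ({u : Fin 3 → Fin (j + 3) ⊕ Fin (j + 3) // Sum.elim id id (u 0) < Sum.elim id id (u 1) ∧ Sum.elim id id (u 1) < Sum.elim id id (u 2)} ⊕ Fin (j + 2) × (Fin (j + 3) ⊕ Fin (j + 3))) →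
      ↥(AddSubgroup.toIntSubmodule (integralForms Φ (2 * j + 3))) := fun k ↦
    ⟨((bS k : ↥(AddSubgroup.toIntSubmodule S)) : E [⋀^Fin (2 * j + 3)]→L[ℝ] ℂ), hSle (SetLike.coe_mem _)⟩
  have hv : ∀ k, ((v k : ↥(AddSubgroup.toIntSubmodule (integralForms Φ (2 * j + 3)))) : E [⋀^Fin (2 * j + 3)]→L[ℝ] ℂ) =
      θ.wedge ((b₃ k : ↥(AddSubgroup.toIntSubmodule (integralForms Φ 3))) : E [⋀^Fin 3]→L[ℝ] ℂ) := fun k ↦ by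
    change ((bS k : ↥(AddSubgroup.toIntSubmodule S)) : E [⋀^Fin (2 * j + 3)]→L[ℝ] ℂ) = _
    rw [Basis.map_apply, LinearEquiv.ofBijective_apply]
    rfl
  -- the pair blocks
  let B : Fin (j + 3) ⊕ Fin (j + 3) → Matrix (Fin (j + 2)) (Fin (j + 2)) ℤ := fun x ↦ Matrix.of fun k' k ↦
    if k' = k then (0 : ℤ) else ((j.factorial * ∏ ν ∈ ({Sum.elim id id x, (Sum.elim id id x).succAbove k,
      (Sum.elim id id x).succAbove k'} : Finset (Fin (j + 3)))ᶜ, d ν : ℕ) : ℤ)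
  -- THE COLUMNS OF THE MATRIX OF `L` (§2): a free word goes to a multiple of its target word …
  have hcol_free : ∀ u, v (Sum.inl u) =
      ((j.factorial * ∏ ν ∈ (Finset.univ.image fun m ↦ Sum.elim id id (u.1 m))ᶜ, d ν : ℕ) : ℤ) • b₂ (Sum.inl u) := fun u ↦ by
    apply Subtype.ext
    rw [Submodule.coe_smul, hv, hb₃l, hb₂l, h.wedgePow_wedge_latMonomial_three_free_eq_single Φ u.1 (T u) rfl, smul_smul,
      ← Int.cast_smul_eq_zsmul ℂ ((j.factorial * ∏ ν ∈ (Finset.univ.image fun m ↦ Sum.elim id id (u.1 m))ᶜ, d ν : ℕ) : ℤ)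
        (latMonomial Φ (2 * j + 3) (Fin.append (ilvWord e₀ (Set.powersetCard.ofFinEmbEquiv.symm (T u))) (⇑e₀ ∘ u.1)))]
    congr 1
    push_cast
    rfl
  -- … and a pair word `(λ_i, μ_i, x)` to the combination `Σ_{k'} B_x(k', k)` of the target words with free letter `x`
  have hcol_pair : ∀ k x, v (Sum.inr (k, x)) = ∑ k', B x k' k • b₂ (Sum.inr (k', x)) := fun k x ↦ by
    apply Subtype.ext
    rw [hv, hb₃r, Submodule.coe_sum, h.wedgePow_wedge_latMonomial_pair_free_eq_sum Φ x k (T' x) (fun _ ↦ rfl) hc,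
      Finset.smul_sum]
    refine Finset.sum_congr rfl fun k' _ ↦ ?_
    rw [Submodule.coe_smul, hb₂r, smul_smul, ← Int.cast_smul_eq_zsmul ℂ (B x k' k) (latMonomial Φ (2 * j + 3)
      ((Fin.append (ilvWord e₀ (Set.powersetCard.ofFinEmbEquiv.symm (T' x k'))) (fun _ : Fin 1 ↦ e₀ x)) ∘ Fin.cast hc))]
    congr 1
    change _ = ((if k' = k then (0 : ℤ) else ((j.factorial * ∏ ν ∈ ({Sum.elim id id x, (Sum.elim id id x).succAbove k,
      (Sum.elim id id x).succAbove k'} : Finset (Fin (j + 3)))ᶜ, d ν : ℕ) : ℤ) : ℤ) : ℂ)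
    by_cases hk : k' = k
    · rw [if_pos hk, if_pos hk, mul_zero, Int.cast_zero]
    · rw [if_neg hk, if_neg hk]
      push_cast
      rfl
  -- the matrix entries
  have hentry_free : ∀ u q, b₂.repr (v (Sum.inl u)) q = if Sum.inl u = q then
      ((j.factorial * ∏ ν ∈ (Finset.univ.image fun m ↦ Sum.elim id id (u.1 m))ᶜ, d ν : ℕ) : ℤ) else 0 := fun u q ↦ by
    rw [hcol_free, map_zsmul, Basis.repr_self, Finsupp.smul_apply, Finsupp.single_apply, smul_eq_mul, mul_ite, mul_one,
      mul_zero]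
  have hentry_pair : ∀ k x q, b₂.repr (v (Sum.inr (k, x))) q =
      Sum.elim (fun _ ↦ (0 : ℤ)) (fun p ↦ if p.2 = x then B x p.1 k else 0) q := fun k x q ↦ by
    have hsum : v (Sum.inr (k, x)) =
        ∑ q, (Sum.elim (fun _ ↦ (0 : ℤ)) (fun p : Fin (j + 2) × (Fin (j + 3) ⊕ Fin (j + 3)) ↦
          if p.2 = x then B x p.1 k else 0) q) • b₂ q := by
      rw [hcol_pair, Fintype.sum_sum_type, Fintype.sum_prod_type]
      simp only [Sum.elim_inl, zero_smul, Finset.sum_const_zero, zero_add, Sum.elim_inr, ite_smul, Finset.sum_ite_eq',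
        Finset.mem_univ, if_true]
    rw [hsum, Basis.repr_sum_self]
  -- BLOCK DIAGONAL
  have hM : b₂.toMatrix v = Matrix.fromBlocks
      (Matrix.diagonal fun u ↦ ((j.factorial * ∏ ν ∈ (Finset.univ.image fun m ↦ Sum.elim id id (u.1 m))ᶜ, d ν : ℕ) : ℤ))
      0 0 (Matrix.blockDiagonal B) := by
    ext q k
    rw [Basis.toMatrix_apply]
    rcases q with u' | ⟨k', x'⟩ <;> rcases k with u | ⟨k, x⟩
    · rw [hentry_free, Matrix.fromBlocks_apply₁₁, Matrix.diagonal_apply]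
      by_cases huu : u' = u
      · subst huu
        rw [if_pos rfl, if_pos rfl]
      · rw [if_neg (fun h' ↦ huu (Sum.inl_injective h').symm), if_neg huu]
    · rw [hentry_pair, Matrix.fromBlocks_apply₁₂, Matrix.zero_apply, Sum.elim_inl]
    · rw [hentry_free, Matrix.fromBlocks_apply₂₁, Matrix.zero_apply, if_neg Sum.inl_ne_inr]
    · rw [hentry_pair, Matrix.fromBlocks_apply₂₂, Matrix.blockDiagonal_apply, Sum.elim_inr]
      by_cases hxx : x' = x
      · subst hxx
        rw [if_pos rfl]
      · rw [if_neg hxx, if_neg hxx]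
  -- the index is `|det|`
  rw [AddSubgroup.relIndex_eq_natAbs_det S (integralForms Φ (2 * j + 3)) hSle bS b₂, Basis.det_apply]
  change (b₂.toMatrix v).det.natAbs = _
  rw [hM, Matrix.det_fromBlocks_zero₂₁, Matrix.det_diagonal, Matrix.det_blockDiagonal, Int.natAbs_mul,
    ← Int.natAbsHom_apply, map_prod, ← Int.natAbsHom_apply, map_prod]
  simp_rw [Int.natAbsHom_apply, Int.natAbs_natCast]
  exact congrArg₂ (· * ·) rfl (Fintype.prod_congr _ _ fun x ↦ natAbs_det_pairBlock₃₇ d (h.pos hη) (Sum.elim id id x))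


/-! ### Principal type: `((g−3)!)^{C(2g,3)} · (g−2)^{2g}` (`C(2g, 3) = rk H³ = 8 C(g,3) + 2g(g−1)`) -/

/-- **Principal type `(1, …, 1)`: `[H^{2g−3}(X, ℤ) : θ^{∧(g−3)} ∧ H³(X, ℤ)] = ((g−3)!)^{C(2g,3)} · (g−2)^{2g}`** (`g = j + 3`) for a
symplectic enumeration of type `(1, …, 1)`: the `1 × 1` blocks contribute `((g−3)!)^{#A}`, the `2g` pair blocks
`((g−3)!)^{g−1} (g−2)` each, and `#A + 2g(g−1) = C(2g, 3) = rk H³(X, ℤ)` (counted through the basis of §4). E.g. `2^8` for a p.p.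
abelian fourfold (`θ ∧ (−) : H³(X, ℤ) → H⁵(X, ℤ)`, the middle-adjacent Lefschetz map), `2^{120} · 3^{10}` for a p.p. fivefold.
[cite: Lange2023AbelianVarietiesComplex, §2.1.1 (principal = type `(1, …, 1)`); §5.4.1 Thm. 5.4.1 and (5.22) (PDF p. 275); §1.1.3 Exercise 1.1.6 (8)] -/
theorem IsSymplecticEnum.relIndex_map_wedgePow_wedge_integralForms_three_hardLefschetz_of_type_one
    (h : IsSymplecticEnum Φ e₀ η d) (hη : IsRiemannForm Φ η) (h1 : ∀ i, d i = 1) :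
    ((integralForms Φ 3).map (AddMonoidHom.mk'
        (fun x : E [⋀^Fin 3]→L[ℝ] ℂ ↦ (wedgePow (ofRealForm η) j).wedge x)
        (ContinuousAlternatingMap.wedge_add_right _))).relIndex (integralForms Φ (2 * j + 3)) =
      j.factorial ^ (2 * (j + 3)).choose 3 * (j + 1) ^ (2 * (j + 3)) := by
  classical
  -- `#A + (g−1) · 2g = C(2g, 3)`: the index type of the basis of `H³(X, ℤ)` of §4 has `rk H³ = C(2g, 3)` elements
  letI : LinearOrder ι := linearOrderOfOrientation (ilvEnum e₀)
  obtain ⟨b₃, -, -⟩ := exists_basis_integralForms_three_freeLetter Φ e₀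
  have hK : Fintype.card {u : Fin 3 → Fin (j + 3) ⊕ Fin (j + 3) // Sum.elim id id (u 0) < Sum.elim id id (u 1) ∧ Sum.elim id id (u 1) < Sum.elim id id (u 2)} +
      (j + 2) * (2 * (j + 3)) = (2 * (j + 3)).choose 3 := by
    have h2 := (Module.finrank_eq_card_basis b₃).symm.trans (finrank_integralForms_eq_choose Φ 3)
    rw [← Fintype.card_congr (ilvEnum e₀), Fintype.card_fin, Fintype.card_sum, Fintype.card_prod, Fintype.card_fin,
      Fintype.card_sum, Fintype.card_fin, ← two_mul] at h2
    exact h2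
  rw [h.relIndex_map_wedgePow_wedge_integralForms_three_hardLefschetz Φ hη]
  simp only [h1, Finset.prod_const_one, mul_one, one_pow, Finset.prod_const, Finset.card_univ, Fintype.card_sum,
    Fintype.card_fin]
  rw [← hK, mul_pow, ← pow_mul, ← mul_assoc, ← pow_add, ← two_mul]

/-! ## §7 Basis-free forms: any presentation of a polarised torus of type `(d₁, …, d_g)`; THE type; principal polarisations -/

/-- **Degree-three hard Lefschetz index, any polarised torus of type `(d₁, …, d_g)`**: for a Riemann form `η` of type `d`
(`IsPolarizationType Φ η d`, `g = j + 3`) on `X = E/Φ(ℤ^ι)` presented by ANY lattice basis,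
`[H^{2g−3}(X, ℤ) : θ^{∧(g−3)} ∧ H³(X, ℤ)] = ∏_{a<b<c, letters} (g−3)! ∏_{ν ∉ {a,b,c}} d_ν · ∏_x ((g−3)!)^{g−1} (∏_{ν ≠ a(x)} d_ν)^{g−3} (g−2)`
(symplectic re-presentation with the same lattice, `IsPolarizationType.exists_isSymplecticEnum`; `Hᵏ(X, ℤ)` depends only on the
lattice). [cite: Lange2023AbelianVarietiesComplex, §1.5.1 (PDF p. 51); §5.4.1 Thm. 5.4.1 and (5.22) (PDF p. 275); §1.1.3 Lemma 1.1.17] [cite: VoisinHodgeI2002, §7.1.2 (PDF p. 134 L31)] -/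
theorem IsPolarizationType.relIndex_map_wedgePow_wedge_integralForms_three_hardLefschetz {Φ : (ι → ℝ) ≃L[ℝ] E}
    (hd : IsPolarizationType Φ η d) (hη : IsRiemannForm Φ η) :
    ((integralForms Φ 3).map (AddMonoidHom.mk'
        (fun x : E [⋀^Fin 3]→L[ℝ] ℂ ↦ (wedgePow (ofRealForm η) j).wedge x)
        (ContinuousAlternatingMap.wedge_add_right _))).relIndex (integralForms Φ (2 * j + 3)) =
      (∏ u : {u : Fin 3 → Fin (j + 3) ⊕ Fin (j + 3) // Sum.elim id id (u 0) < Sum.elim id id (u 1) ∧ Sum.elim id id (u 1) < Sum.elim id id (u 2)},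
          (j.factorial * ∏ ν ∈ (Finset.univ.image fun m ↦ Sum.elim id id (u.1 m))ᶜ, d ν)) *
        ∏ x : Fin (j + 3) ⊕ Fin (j + 3),
          (j.factorial ^ (j + 2) * (∏ ν ∈ ({Sum.elim id id x} : Finset (Fin (j + 3)))ᶜ, d ν) ^ j * (j + 1)) := by
  obtain ⟨Φ', hΛ, hs⟩ := hd.exists_isSymplecticEnum Φ
  rw [integralForms_eq_of_range_latticeVec_eq hΛ.symm 3, integralForms_eq_of_range_latticeVec_eq hΛ.symm (2 * j + 3)]
  exact hs.relIndex_map_wedgePow_wedge_integralForms_three_hardLefschetz Φ' (hη.of_range_latticeVec_subset hΛ.le)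

/-- **Type `(1, …, 1)`, any presentation: `[H^{2g−3}(X, ℤ) : θ^{∧(g−3)} ∧ H³(X, ℤ)] = ((g−3)!)^{C(2g,3)} · (g−2)^{2g}`** (`g = j + 3`).
[cite: Lange2023AbelianVarietiesComplex, §2.1.1; §5.4.1 Thm. 5.4.1 and (5.22) (PDF p. 275)] -/
theorem IsPolarizationType.relIndex_map_wedgePow_wedge_integralForms_three_hardLefschetz_of_type_one {Φ : (ι → ℝ) ≃L[ℝ] E}
    (hd : IsPolarizationType Φ η d) (hη : IsRiemannForm Φ η) (h1 : ∀ i, d i = 1) :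
    ((integralForms Φ 3).map (AddMonoidHom.mk'
        (fun x : E [⋀^Fin 3]→L[ℝ] ℂ ↦ (wedgePow (ofRealForm η) j).wedge x)
        (ContinuousAlternatingMap.wedge_add_right _))).relIndex (integralForms Φ (2 * j + 3)) =
      j.factorial ^ (2 * (j + 3)).choose 3 * (j + 1) ^ (2 * (j + 3)) := by
  obtain ⟨Φ', hΛ, hs⟩ := hd.exists_isSymplecticEnum Φ
  rw [integralForms_eq_of_range_latticeVec_eq hΛ.symm 3, integralForms_eq_of_range_latticeVec_eq hΛ.symm (2 * j + 3)]
  exact hs.relIndex_map_wedgePow_wedge_integralForms_three_hardLefschetz_of_type_one Φ'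
    (hη.of_range_latticeVec_subset hΛ.le) h1

/-- **The degree-three hard Lefschetz index for THE type of a Riemann form** (`IsRiemannForm.polarizationType`, the elementary
divisors of `E|_Λ`; `|ι| = 2g`, `g = j + 3`). [cite: Lange2023AbelianVarietiesComplex, §1.5.1 (PDF p. 51); §5.4.1 Thm. 5.4.1 and (5.22) (PDF p. 275)] [cite: VoisinHodgeI2002, §7.1.2 (PDF p. 134 L31)] -/
theorem IsRiemannForm.relIndex_map_wedgePow_wedge_integralForms_three_hardLefschetz {Φ : (ι → ℝ) ≃L[ℝ] E}
    (hη : IsRiemannForm Φ η) (hj : j + 3 = Fintype.card ι / 2) :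
    ((integralForms Φ 3).map (AddMonoidHom.mk'
        (fun x : E [⋀^Fin 3]→L[ℝ] ℂ ↦ (wedgePow (ofRealForm η) j).wedge x)
        (ContinuousAlternatingMap.wedge_add_right _))).relIndex (integralForms Φ (2 * j + 3)) =
      (∏ u : {u : Fin 3 → Fin (j + 3) ⊕ Fin (j + 3) // Sum.elim id id (u 0) < Sum.elim id id (u 1) ∧ Sum.elim id id (u 1) < Sum.elim id id (u 2)},
          (j.factorial * ∏ ν ∈ (Finset.univ.image fun m ↦ Sum.elim id id (u.1 m))ᶜ, hη.polarizationType (Fin.cast hj ν))) *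
        ∏ x : Fin (j + 3) ⊕ Fin (j + 3), (j.factorial ^ (j + 2) *
          (∏ ν ∈ ({Sum.elim id id x} : Finset (Fin (j + 3)))ᶜ, hη.polarizationType (Fin.cast hj ν)) ^ j * (j + 1)) :=
  (hη.isPolarizationType_polarizationType.comp_cast hj).relIndex_map_wedgePow_wedge_integralForms_three_hardLefschetz hη

/-- **Principal polarisation: `[H^{2g−3}(X, ℤ) : θ^{∧(g−3)} ∧ H³(X, ℤ)] = ((g−3)!)^{C(2g,3)} · (g−2)^{2g}`** (type `(1, …, 1)`;
`|ι| = 2g`, `g = j + 3`): **`2^8` for the middle-adjacent Lefschetz map `θ ∧ (−) : H³(X, ℤ) → H⁵(X, ℤ)` of a principally polarised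
abelian fourfold**, `2^{120} · 3^{10}` for `θ² ∧ (−) : H³ → H⁷` on a p.p. fivefold; for a p.p. threefold (`j = 0`) the statement is
the trivial `[H³ : H³] = 1`. [cite: Lange2023AbelianVarietiesComplex, §2.1.1 (principal = type `(1, …, 1)`); §5.4.1 Thm. 5.4.1 and (5.22) (PDF p. 275)] [cite: VoisinHodgeI2002, §6.2.3 Thm. 6.25 (PDF p. 125); §7.1.2 (PDF p. 134 L31)] -/
theorem IsPrincipalPolarization.relIndex_map_wedgePow_wedge_integralForms_three_hardLefschetz {Φ : (ι → ℝ) ≃L[ℝ] E}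
    (hp : IsPrincipalPolarization Φ η) (hj : Fintype.card ι = 2 * (j + 3)) :
    ((integralForms Φ 3).map (AddMonoidHom.mk'
        (fun x : E [⋀^Fin 3]→L[ℝ] ℂ ↦ (wedgePow (ofRealForm η) j).wedge x)
        (ContinuousAlternatingMap.wedge_add_right _))).relIndex (integralForms Φ (2 * j + 3)) =
      j.factorial ^ (2 * (j + 3)).choose 3 * (j + 1) ^ (2 * (j + 3)) := by
  obtain ⟨g, d', hd', h1⟩ := hp.exists_type_eq_one
  have hg : j + 3 = g := by have := hd'.card_eq; omega
  exact (hd'.comp_cast hg).relIndex_map_wedgePow_wedge_integralForms_three_hardLefschetz_of_type_one hp.isRiemannForm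
    fun i ↦ h1 _

end HardLefschetzDegreeThree

end Literature.Geometry.Kaehler.ComplexTorus
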